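import Literature.NumberTheory.EllipticCurves.BSDWave0
import Literature.NumberTheory.EllipticCurves.Selmer
import Literature.NumberTheory.EllipticCurves.RootNumber
import Literature.NumberTheory.EllipticCurves.SelmerProofs
import Literature.NumberTheory.EllipticCurves.SelmerFiniteProofs
import Literature.NumberTheory.EllipticCurves.MordellWeilTheoremProofs
import Literature.NumberTheory.GaloisRepresentations.ContinuousH1
import Literature.NumberTheory.EllipticCurves.DivisionPolynomialTorsion
import Mathlib.LinearAlgebra.Dimension.Torsion.Finite
import Mathlib.GroupTheory.PGroup
import Mathlib.Analysis.SpecialFunctions.Pow.Asymptotics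
import Mathlib.Analysis.SpecialFunctions.Pow.Real
import Mathlib.Data.Nat.Factorization.Basic
import Mathlib.Data.Int.Interval
import HarnessLib

/-!
# A positive proportion of elliptic curves over `ℚ` have rank `0`: Bhargava–Shankar's proof,
# reduced to its four inputs

Topic `Literature/NumberTheory/EllipticCurves`, family `bsd` (**bsd.S26**). This file serves the named
fact `Literature.NumberTheory.EllipticCurves.pos_proportion_rank_zero` of `BSDWave0.lean`:

> M. Bhargava, A. Shankar, *Ternary cubic forms having bounded invariants, and the existence of a
> positive proportion of elliptic curves having rank 0*, Ann. of Math. 181 (2015) 587–621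
> (arXiv:1007.0052v2), **Theorem 4**: "When all elliptic curves `E/ℚ` are ordered by height, a
> positive proportion of them have rank `0`."

The printed proof (§4.1 of the source) is a two-page deduction from four inputs. Following the
decomposition protocol for facts of this size, the three deep inputs (Thm 27, the root-number
family of §4.1, Thm 42) are vendored here as named facts (`def … : Prop`, cited to the theorem
numbers of arXiv:1007.0052**v2**, 24 Dec 2013, whose abstract is the published one; the `lit` store
holds v1, whose numbering differs: v1 Thm 26/37/38 = v2 Thm 27/41/42), the fourth input (the
source's use of its Lemma 19: curves with a rational `3`-torsion point are negligible) is **proved**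
by an elementary count, and the deduction itself is **proved**:
`Literature.NumberTheory.EllipticCurves.pos_proportion_rank_zero_of_facts`.

## The printed proof (source, §4.1, proof of Thm 41 and the two paragraphs following it)

Let `F` be the explicit family of §4.1 (`E` and `E₋₁` both additive at `2` with `2`-adic unit
`j`-invariants; squarefree discriminant away from `2`; `Δ'(E) ≡ 1 (mod 4)`). It is a (positive
proportion) large family, stable under `E ↦ E₋₁ = E_{A,-B}` (the quadratic twist by `-1`, which
preserves the height), and `ω(E₋₁) = -ω(E)` on `F`; hence exactly `50%` of `F` has root number `+1`.
"First note that Lemma 19 implies that the number of elliptic curves over `ℚ` that have a nontrivial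
rational `3`-torsion point is negligible. Thus for a density of `100%` of elliptic curves `E`, we have
`r_p(E) = s_p(E)`. Now, by Theorem 27, the average size of the `3`-Selmer group of curves in `F` is at
most `4`. On the other hand, by Theorem 42 [Dokchitser–Dokchitser] we know that exactly `50%` of
the curves in `F` have odd `3`-Selmer rank and thus have at least `3` elements in the `3`-Selmer
group. Hence the average size of the `3`-Selmer groups among the `50%` of elliptic curves in `F`
having even `3`-Selmer rank is at most `5`. Now if the `3`-Selmer group of an elliptic curve has even
rank, then it must have size `1`, `9`, or more than `9`. For the average of such sizes to be `5`, at
least half must be equal to `1`. Thus among these `50%` of curves in `F` having even `3`-Selmer rank,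
at least half have trivial `3`-Selmer group, and therefore have rank `0`."

## Contents

* `heightAverageOn S f X`: the average of `f` over the members of a subfamily `S` of naive height
  `< X` (the prelude's `Literature.NumberTheory.EllipticCurves.heightAverage` is the case `S = ⊤`).
* `CongruenceFamily`, `CongruenceFamily.Mem`, `CongruenceFamily.IsLarge`, `UnionMem`: families of
  curves `E_{A,B}` defined by congruence conditions and *large* families (source §3, first page;
  Bhargava–Skinner–Zhang, arXiv:1407.1826, §2.3), in the generality needed here: at each prime the
  local condition is a set of residues of `(A, B)` modulo a fixed power `p ^ k_p` (a clopen
  condition), plus a sign condition at infinity.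
* Named facts (all `[cite: BhargavaShankarTernary2015, …]`, v2 numbering):
  `heightAverageOn_card_selmerThree_le_four` (Thm 27), `exists_isLarge_rootNumber_twist_family`
  (§4.1 with Thm 37), `even_selmerRank_sub_torsionRank_iff` (Thm 42 = Dokchitser–Dokchitser, Ann.
  of Math. 172 (2010) Thm 1.4, in the `p`-Selmer form printed by the source and by
  Bhargava–Skinner–Zhang Thm 15).
* Proved, the fourth input: `hasHeightDensity_torsionBy_three_eq_bot` — the proportion of curves
  `E_{A,B}` of naive height `< X` with `E(ℚ)[3] = 0` tends to `1` (Lemma 19 as used in the first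
  lines of the proof of Thm 41), by the elementary count of Harron–Snowden type: a rational point
  of order `3` gives a rational root `x` of `Ψ₃ = 3x⁴ + 6Ax² + 12Bx - A²` (the tree's
  `three_smul_some_eq_zero_iff`), `m = 3x ∈ ℤ` with `m⁶ ≤ 39366·X`, and `(A, m)` determines `B`
  when `A ≠ 0`, so at most `40X^{1/2} + 2` curves of height `< X` are exceptional
  (`card_filter_torsionBy_three_ne_bot_le`), against at least `(3/4)⌊(X/5)^{1/3}⌋⌊(X/28)^{1/2}⌋`
  curves in all (`card_heightFamilyBelow_ge`).
* Proved: every class of `H¹(K, E[n])` is killed by `n`, so `#Sel^(p)(E/K)` and `#E(K)[p]` are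
  powers of `p` (`exists_natCard_selmerGroup_eq_pow`, `exists_natCard_torsionBy_eq_pow`; finiteness
  from the tree's `finite_selmerGroup_holds`, Silverman X.4.2(b), and `module_finite_point_holds`,
  the Mordell–Weil theorem); `Sel^(p)(E/K) = 0 ⇒ rank E(K) = 0 ∧ E(K)[p] = 0`
  (`mordellWeilRank_eq_zero_and_torsionBy_eq_bot_of_selmerGroup_eq_bot`, from the Kummer sequence
  `exists_kummerMap_holds`, Silverman X.4.2(a), and Nakayama's lemma over `ℤ`); the three per-curve
  consequences of the parity fact used in the quoted proof
  (`three_le_natCard_selmerGroup_of_rootNumber_eq_neg_one`,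
  `natCard_selmerGroup_eq_one_or_nine_le`); the involution `(A, B) ↦ (A, -B)` on the height family
  (`negB`, `card_filter_rootNumber_eq_one_eq`); averages over finite disjoint unions
  (`eventually_sum_le_of_heightAverageOn_le`); the quoted Markov-type counting (`markov_step`, with
  the constant `25%` weakened to `1/18` of the density of `F`, which is all Theorem 4 needs); and the
  assembly `pos_proportion_rank_zero_of_facts` (hypotheses: the three named facts).

## Remarks on faithfulness

* The source's Theorem 27 asserts *equality* (`= 4`) of the limit for every large family in its
  (more general: closed `Σ_p` with arbitrary shape) sense; the vendored fact keeps only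
  `limsup ≤ 4`, for the clopen congruence families defined here, whose largeness condition
  `IsLarge` transcribes the source's "the `p`-adic closure `Inv_p(F)` contains all pairs with
  `p² ∤ Δ`" literally (density of members in every residue class). It is therefore weaker than the
  printed theorem.
* The source's family `F` of §4.1 is the disjoint union of its two sign pieces `F ∩ {Δ > 0}`,
  `F ∩ {Δ < 0}` (the condition `Δ' = |Δ/2^{v₂(Δ)}| ≡ 1 (mod 4)` couples the sign with a `2`-adic
  congruence), each a large family with a sign condition at infinity; the existence fact is stated
  for finite *pairwise disjoint* unions of large congruence families, and the average over such a
  union is bounded in Lean from the single-family fact. (arXiv v1 used a different family and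
  stated Theorem 42 without the torsion term `t_p`; both points were corrected in v2, which is the
  text followed here.)
* Root numbers are the tree's analytic `WeierstrassCurve.rootNumber` (sign of the functional
  equation), as in `Literature.NumberTheory.EllipticCurves.p_parity` (`BSDSelmer.lean`); the source defines `ω(E)` the same way
  (§4.1: "its root number—that is, the sign of the functional equation of the L-function").
* `DecidableEq ℚ`: statements about `E(ℚ) = W.toAffine.Point` for a curve over `ℚ` elaborate the
  group law against `instDecidableEqRat`, whereas the general-field lemmas (and the prelude facts)
  carry the classical instance; the two (subsingleton) instances are bridged by `convert` where
  needed, as in `ComplexMultiplication.lean`.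

## References

* [BhargavaShankarTernary2015] M. Bhargava, A. Shankar, Ann. of Math. (2) 181 (2015), no. 2,
  587–621, doi:10.4007/annals.2015.181.2.4 = arXiv:1007.0052v2: Thm 4, §3 (families, p. 14),
  Thm 27, Thm 37, Lemma 19, Thm 41, Thm 42, §4.1.
* [DokchitserDokchitserAnnals2010] T. Dokchitser, V. Dokchitser, *On the Birch–Swinnerton-Dyer
  quotients modulo squares*, Ann. of Math. 172 (2010) 567–596, Thm 1.4.
* [BhargavaSkinnerZhang2014] M. Bhargava, C. Skinner, W. Zhang, *A majority of elliptic curves over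
  `ℚ` satisfy the Birch and Swinnerton-Dyer conjecture*, arXiv:1407.1826, §2.3 (large families),
  Thm 13, Thm 15, Lemma 20.
* [BhargavaShankar5Selmer2013] M. Bhargava, A. Shankar, arXiv:1312.7859, §5 (root numbers in large
  families via the twist by `-1`).
* [SilvermanAEC2009] J. H. Silverman, *The Arithmetic of Elliptic Curves*, 2nd ed., Thm VIII.6.7,
  Thm X.4.2, Exercise 3.7.
* R. Harron, A. Snowden, *Counting elliptic curves with prescribed torsion*, J. reine angew. Math.
  729 (2017) 151–170 (arXiv:1311.4920), §1.4 (the count behind the torsion estimate; not cited in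
  `[cite:]` form).
-/

noncomputable section

open scoped Classical
open scoped AddSubgroup
open Filter Topology Polynomial WeierstrassCurve Literature.NumberTheory.EllipticCurves Literature.NumberTheory.GaloisRepresentations

namespace Literature.NumberTheory.EllipticCurves

universe u

/-! ### `H¹(K, E[n])` is killed by `n`; orders of `Sel^(p)` and `E(K)[p]` -/

section H1Torsion

variable {K : Type u} [Field K] (W : WeierstrassCurve K)

/-- Every class of `H¹(K, E[n]) = H¹_cont(Γ_K, E(K̄)[n])` is killed by `n`: a class is represented
by a continuous crossed homomorphism with values in `E[n]` (`Literature.NumberTheory.GaloisRepresentations.oneCocycleClass_surjective`), and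
`n` kills `E[n]` pointwise. Silverman, *AEC*, X.§4 (the `m`-torsion group `H¹(G, E[m])`);
Serre, *Galois Cohomology*, I.§2.2. [folklore] -/
theorem zsmul_galH1Torsion_eq_zero (n : ℤ) (x : W.galH1Torsion n) : n • x = 0 := by
  obtain ⟨φ, rfl⟩ := oneCocycleClass_surjective
    (discreteTopRep (Field.absoluteGaloisGroup K) (W.geomTorsion n)) x
  have hφ : n • φ = 0 := by
    apply Subtype.ext
    ext g
    rw [Submodule.coe_smul, ContinuousMap.smul_apply, Submodule.coe_zero, ContinuousMap.zero_apply]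
    have hg : n • ((φ.1 g : W.geomTorsion n) : W.geomPoints) = 0 :=
      (Submodule.mem_torsionBy_iff n _).mp (φ.1 g).2
    rw [AddSubgroupClass.coe_zsmul, ZeroMemClass.coe_zero]
    exact hg
  have h := oneCocycleClass_smul
    (discreteTopRep (Field.absoluteGaloisGroup K) (W.geomTorsion n)) n φ
  rw [hφ, oneCocycleClass_zero] at h
  rw [← int_smul_eq_zsmul (ModuleCat.isModule _)]
  exact h.symm

/-- The order of a finite abelian group killed by the prime `p` is a power of `p` (it is a
`p`-group; Mathlib `IsPGroup.iff_card` through `Multiplicative`). [folklore] -/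
theorem exists_natCard_eq_pow_of_nsmul_eq_zero {G : Type*} [AddCommGroup G] [Finite G] (p : ℕ)
    [Fact p.Prime] (h : ∀ x : G, p • x = 0) : ∃ k : ℕ, Nat.card G = p ^ k := by
  have hP : IsPGroup p (Multiplicative G) := fun g ↦ ⟨1, by
    rw [pow_one, ← ofAdd_toAdd g, ← ofAdd_nsmul, h, ofAdd_zero]⟩
  obtain ⟨k, hk⟩ := IsPGroup.iff_card.mp hP
  exact ⟨k, by rw [← hk]; exact (Nat.card_congr Multiplicative.toAdd).symm⟩

/-- For an elliptic curve over a number field and a prime `p`, `#Sel^(p)(E/K) = p ^ s` for some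
`s` (the `p`-Selmer rank `s = s_p(E)` of the source, Thm 42): `Sel^(p)` is finite (Silverman X.4.2(b),
the tree's `finite_selmerGroup_holds`) and killed by `p` (`zsmul_galH1Torsion_eq_zero`).
[cite: SilvermanAEC2009, Thm X.4.2(b)] -/
theorem exists_natCard_selmerGroup_eq_pow [NumberField K] [W.IsElliptic] (p : ℕ) [Fact p.Prime] :
    ∃ s : ℕ, Nat.card (W.selmerGroup p) = p ^ s := by
  haveI : Finite (W.selmerGroup p) :=
    W.finite_selmerGroup_holds (n := p) (by exact_mod_cast (Fact.out : p.Prime).ne_zero)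
  refine exists_natCard_eq_pow_of_nsmul_eq_zero p fun x ↦ Subtype.ext ?_
  rw [AddSubgroupClass.coe_nsmul, ZeroMemClass.coe_zero, ← natCast_zsmul]
  exact zsmul_galH1Torsion_eq_zero W p x.1

end H1Torsion

section MordellWeilGroup

variable {K : Type u} [Field K] [NumberField K] (W : WeierstrassCurve K) [W.IsElliptic]

/-- For an elliptic curve over a number field and a prime `p`, `#E(K)[p] = p ^ t` for some `t`
(the `t = t_p(E)` of the source, Thm 42): by the Mordell–Weil theorem (the tree's
`module_finite_point_holds`, Silverman VIII.6.7) `E(K)[p]` is a finitely generated `ℤ`-module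
killed by `p`, hence finite of `p`-power order. [cite: SilvermanAEC2009, Thm. VIII.6.7] -/
theorem exists_natCard_torsionBy_eq_pow (p : ℕ) [Fact p.Prime] :
    ∃ t : ℕ, Nat.card (W.toAffine.Point[(p : ℤ)]) = p ^ t := by
  haveI : Module.Finite ℤ W.toAffine.Point := W.module_finite_point_holds
  haveI : IsNoetherian ℤ W.toAffine.Point := isNoetherian_of_isNoetherianRing_of_finite ℤ _
  haveI : Module.Finite ℤ (Submodule.torsionBy ℤ W.toAffine.Point (p : ℤ)) :=
    Module.IsNoetherian.finite ℤ _
  have htors : Module.IsTorsion ℤ (Submodule.torsionBy ℤ W.toAffine.Point (p : ℤ)) := fun x ↦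
    ⟨⟨(p : ℤ), mem_nonZeroDivisors_of_ne_zero (by exact_mod_cast (Fact.out : p.Prime).ne_zero)⟩,
      Subtype.ext (by
        rw [Submonoid.mk_smul, Submodule.coe_smul, Submodule.coe_zero]
        exact (Submodule.mem_torsionBy_iff _ _).mp x.2)⟩
  haveI : Finite (Submodule.torsionBy ℤ W.toAffine.Point (p : ℤ)) :=
    Module.finite_of_fg_torsion _ htors
  haveI : Finite (W.toAffine.Point[(p : ℤ)]) := ‹Finite (Submodule.torsionBy ℤ W.toAffine.Point p)›
  refine exists_natCard_eq_pow_of_nsmul_eq_zero p fun x ↦ Subtype.ext ?_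
  rw [AddSubgroupClass.coe_nsmul, ZeroMemClass.coe_zero, ← natCast_zsmul]
  exact (Submodule.mem_torsionBy_iff _ _).mp x.2

/-- **Trivial `p`-Selmer group ⇒ rank `0` and no rational `p`-torsion** ("have trivial `3`-Selmer
group, and therefore have rank `0`", source, proof of Thm 41). If `Sel^(p)(E/K) = 0` then the Kummer
map `E(K)/pE(K) ↪ Sel^(p)(E/K)` (Silverman X.4.2(a); the tree's `exists_kummerMap_holds`) forces
`E(K) = pE(K)`; as `E(K)` is finitely generated (Mordell–Weil, `module_finite_point_holds`),
Nakayama's lemma gives `r ∈ 1 + pℤ` with `r • E(K) = 0`, so `E(K)` is torsion (`rank_ℤ = 0`,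
Mathlib `Module.finrank_eq_zero_iff_isTorsion`) and `E(K)[p] = 0` (`P = rP - m(pP) = 0`).
[cite: SilvermanAEC2009, Thm X.4.2(a)] -/
theorem mordellWeilRank_eq_zero_and_torsionBy_eq_bot_of_selmerGroup_eq_bot (p : ℕ) [Fact p.Prime]
    (h : W.selmerGroup p = ⊥) : W.mordellWeilRank = 0 ∧ W.toAffine.Point[(p : ℤ)] = ⊥ := by
  have hp0 : (p : ℤ) ≠ 0 := by exact_mod_cast (Fact.out : p.Prime).ne_zero
  obtain ⟨κ, hker, hrange⟩ := W.exists_kummerMap_holds (n := p) hp0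
  have hκ : κ = 0 := by
    rw [← AddMonoidHom.range_eq_bot_iff, hrange, h, bot_inf_eq]
  have hdiv : ∀ P : W.toAffine.Point, ∃ Q : W.toAffine.Point, (p : ℤ) • Q = P := fun P ↦ by
    have hP : P ∈ κ.ker := by rw [hκ]; trivial
    rw [hker] at hP
    obtain ⟨Q, hQ⟩ := hP
    exact ⟨Q, hQ⟩
  haveI : Module.Finite ℤ W.toAffine.Point := W.module_finite_point_holds
  obtain ⟨r, hr1, hr⟩ := Submodule.exists_sub_one_mem_and_smul_eq_zero_of_fg_of_le_smul
    (Ideal.span {(p : ℤ)}) (⊤ : Submodule ℤ W.toAffine.Point) Module.Finite.fg_top (fun P _ ↦ by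
      obtain ⟨Q, hQ⟩ := hdiv P
      rw [← hQ]
      exact Submodule.smul_mem_smul (Ideal.mem_span_singleton_self _) Submodule.mem_top)
  have hr0 : r ≠ 0 := by
    rintro rfl
    rw [zero_sub, Ideal.mem_span_singleton, (dvd_neg).trans Int.natCast_dvd_ofNat] at hr1
    exact (Fact.out : p.Prime).ne_one (Nat.dvd_one.mp hr1)
  refine ⟨?_, ?_⟩
  · rw [WeierstrassCurve.mordellWeilRank, Module.finrank_eq_zero_iff_isTorsion]
    exact fun P ↦ ⟨⟨r, mem_nonZeroDivisors_of_ne_zero hr0⟩, hr P Submodule.mem_top⟩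
  · rw [eq_bot_iff]
    intro P hP
    have hP' : (p : ℤ) • P = 0 := (Submodule.mem_torsionBy_iff _ _).mp hP
    obtain ⟨m, hm⟩ := (Ideal.mem_span_singleton).mp hr1
    have : P = r • P - m • ((p : ℤ) • P) := by
      rw [smul_smul, ← sub_smul, mul_comm, ← hm, sub_sub_cancel, one_smul]
    rw [AddSubgroup.mem_bot, this, hr P Submodule.mem_top, hP', smul_zero, sub_zero]

end MordellWeilGroup

/-! ### Thm 42 (Dokchitser–Dokchitser): parity of the `p`-Selmer rank -/

section Parity

/-- **Thm 42 of the source (Dokchitser–Dokchitser; T. Dokchitser, V. Dokchitser, Ann. of Math. 172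
(2010), Thm 1.4, see also Nekovář), as printed by Bhargava–Shankar and by Bhargava–Skinner–Zhang
(arXiv:1407.1826, Thm 15).** "Let `E` be an elliptic curve over `ℚ` and let `p` be any prime. Let
`s_p(E)` and `t_p(E)` denote the rank of the `p`-Selmer group of `E` and the rank of `E(ℚ)[p]`,
respectively. Then the quantity `r_p(E) := s_p(E) − t_p(E)` is even if and only if the root number
of `E` is `+1`." Here the ranks of the elementary abelian `p`-groups `Sel^(p)(E/ℚ) = W.selmerGroup p`
(`Selmer.lean`) and `E(ℚ)[p]` are the exponents `s`, `t` with `#Sel^(p) = p ^ s`, `#E(ℚ)[p] = p ^ t`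
(they exist: `exists_natCard_selmerGroup_eq_pow`, `exists_natCard_torsionBy_eq_pow`), and the root
number is `WeierstrassCurve.rootNumber` (`RootNumber.lean`), as in the corank form
`Literature.NumberTheory.EllipticCurves.p_parity` of `BSDSelmer.lean` (Dokchitser–Dokchitser's own formulation,
`(-1)^{corank Sel_{p^∞}} = w`; the two agree by the Cassels–Tate pairing).
[cite: BhargavaShankarTernary2015, Thm 42 (arXiv v2 numbering; = v1 Thm 38)]
[cite: DokchitserDokchitserAnnals2010, Thm 1.4] -/
def even_selmerRank_sub_torsionRank_iff : Prop :=
  ∀ (W : WeierstrassCurve ℚ) [W.IsElliptic] (p : ℕ) [Fact p.Prime] (s t : ℕ),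
    Nat.card (W.selmerGroup p) = p ^ s → Nat.card (W.toAffine.Point[(p : ℤ)]) = p ^ t →
      (Even ((s : ℤ) - t) ↔ W.rootNumber = 1)

variable (hDD : even_selmerRank_sub_torsionRank_iff) (W : WeierstrassCurve ℚ) [W.IsElliptic]

/-- Over `ℚ` (instance bridge, see the module docstring): `#E(ℚ)[3] = 3 ^ t` for some `t`
(`exists_natCard_torsionBy_eq_pow`). [cite: SilvermanAEC2009, Thm. VIII.6.7] -/
theorem exists_natCard_torsionBy_three_eq_pow :
    ∃ t : ℕ, Nat.card (W.toAffine.Point[((3 : ℕ) : ℤ)]) = 3 ^ t := by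
  obtain ⟨t, ht⟩ := exists_natCard_torsionBy_eq_pow W 3
  exact ⟨t, by convert ht⟩

/-- Over `ℚ` (instance bridge): `#Sel^(3)(E/ℚ) = 1` forces `rank E(ℚ) = 0` and `E(ℚ)[3] = 0`
(`mordellWeilRank_eq_zero_and_torsionBy_eq_bot_of_selmerGroup_eq_bot`; "have trivial `3`-Selmer
group, and therefore have rank `0`", source, proof of Thm 41). [cite: SilvermanAEC2009, Thm X.4.2(a)] -/
theorem mordellWeilRank_eq_zero_and_torsionBy_eq_bot_of_natCard_selmerGroup_eq_one
    (h : Nat.card (W.selmerGroup 3) = 1) :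
    W.mordellWeilRank = 0 ∧ W.toAffine.Point[(3 : ℤ)] = ⊥ := by
  have hbot : W.selmerGroup 3 = ⊥ := by
    have := (Nat.card_eq_one_iff_unique.mp h).1
    exact (W.selmerGroup 3).eq_bot_of_subsingleton
  have h' := mordellWeilRank_eq_zero_and_torsionBy_eq_bot_of_selmerGroup_eq_bot W 3 hbot
  exact ⟨h'.1, by (convert h'.2; rfl)⟩

include hDD

/-- **Odd parity** (source, proof of Thm 41: the curves with root number `-1` "have odd `3`-Selmer
rank and thus have at least `3` elements in the `3`-Selmer group"), made unconditional in the
torsion: if `w(E) = -1` then `3 ≤ #Sel^(3)(E/ℚ)`. Indeed if `Sel^(3) = 0` then `E(ℚ)[3] = 0`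
(previous lemma), so `s = t = 0` and Thm 42 gives `w(E) = +1`.
[cite: BhargavaShankarTernary2015, proof of Thm 41 (arXiv v2 numbering)] -/
theorem three_le_natCard_selmerGroup_of_rootNumber_eq_neg_one (hw : W.rootNumber = -1) :
    3 ≤ Nat.card (W.selmerGroup 3) := by
  obtain ⟨s, hs⟩ := exists_natCard_selmerGroup_eq_pow W 3
  obtain ⟨t, ht⟩ := exists_natCard_torsionBy_three_eq_pow W
  have hpar := hDD W 3 s t hs ht
  rw [Nat.cast_ofNat] at hs ht
  rcases Nat.eq_zero_or_pos s with rfl | hspos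
  · exfalso
    rw [pow_zero] at hs
    have htors :=
      (mordellWeilRank_eq_zero_and_torsionBy_eq_bot_of_natCard_selmerGroup_eq_one W hs).2
    have ht0 : t = 0 := by
      rw [htors, Nat.card_unique] at ht
      exact (Nat.pow_right_injective (by norm_num : 2 ≤ 3) ((pow_zero 3).trans ht)).symm
    have hw1 : W.rootNumber = 1 := hpar.mp (by rw [ht0]; norm_num)
    rw [hw1] at hw
    norm_num at hw
  · rw [hs]
    calc 3 = 3 ^ 1 := (pow_one 3).symm
      _ ≤ 3 ^ s := Nat.pow_le_pow_right (by norm_num) hspos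

/-- **Even parity** (source, proof of Thm 41: "if the `3`-Selmer group of an elliptic curve has even
rank, then it must have size `1`, `9`, or more than `9`"), for curves with root number `+1` and no
rational `3`-torsion (so that `r_3 = s_3` in Thm 42): `#Sel^(3) = 1` or `9 ≤ #Sel^(3)`.
[cite: BhargavaShankarTernary2015, proof of Thm 41 (arXiv v2 numbering)] -/
theorem natCard_selmerGroup_eq_one_or_nine_le (hw : W.rootNumber = 1)
    (htors : W.toAffine.Point[(3 : ℤ)] = ⊥) :
    Nat.card (W.selmerGroup 3) = 1 ∨ 9 ≤ Nat.card (W.selmerGroup 3) := by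
  obtain ⟨s, hs⟩ := exists_natCard_selmerGroup_eq_pow W 3
  have ht : Nat.card (W.toAffine.Point[((3 : ℕ) : ℤ)]) = 3 ^ 0 := by
    rw [Nat.cast_ofNat, htors, pow_zero, Nat.card_unique]
  have heven : Even s := by
    have := (hDD W 3 s 0 hs ht).mpr hw
    simpa using this
  rw [Nat.cast_ofNat] at hs
  rw [hs]
  rcases Nat.eq_zero_or_pos s with rfl | hspos
  · exact Or.inl (pow_zero 3)
  · right
    obtain ⟨k, rfl⟩ := heven
    calc 9 = 3 ^ (1 + 1) := by norm_num
      _ ≤ 3 ^ (k + k) := Nat.pow_le_pow_right (by norm_num) (by omega)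

end Parity

/-! ### Large families (source §3) and the remaining three inputs -/

section Families

/-- The average of a real-valued invariant `f` over the curves `E_{A,B}` of the subfamily `S`
having naive height `< X` (`∑_{E ∈ S, H(E) < X} f(E) / #{E ∈ S : H(E) < X}`, the shape of the
averages in Thm 27/Thm 39 of the source; junk value `0` when no member has height `< X`). For
`S = ⊤` this is the prelude's `Literature.NumberTheory.EllipticCurves.heightAverage`.
[cite: BhargavaShankarTernary2015, Thm 27 and (the display of) Thm 39 (arXiv v2 numbering)] -/
def heightAverageOn (S : ℤ × ℤ → Prop) (f : ℤ × ℤ → ℝ) (X : ℕ) : ℝ :=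
  (∑ AB ∈ (heightFamilyBelow X).filter S, f AB) / ((heightFamilyBelow X).filter S).card

/-- Data of a **family of elliptic curves `E_{A,B}` defined by congruence conditions** (source §3,
p. 14: a closed set `Σ_p ⊆ ℤ_p²` of allowed pairs at every prime `p`, and a "congruence condition at
infinity" `Σ_∞ ∈ {Δ > 0, Δ < 0, Δ ≠ 0}`; Bhargava–Skinner–Zhang, arXiv:1407.1826, §2.3), in the
clopen generality used by the constructions of the source's §4.1: at the prime `p` the condition is
membership of the residue of `(A, B)` modulo `p ^ expt p` in `residues p`; at infinity, `allowPos`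
(resp. `allowNeg`) says whether curves of positive (resp. negative) discriminant
`Δ(A, B) = -4A³ - 27B²` are allowed. (The source indexes curves by `(I, J) = (-3A, -27B)`, an
injective linear change of coordinates, so closed conditions on `(I, J)` and on `(A, B)` correspond.)
[cite: BhargavaShankarTernary2015, §3 (families defined by congruence conditions; arXiv v2 p. 14)] -/
structure CongruenceFamily where
  /-- the exponent `k_p` of the modulus `p ^ k_p` of the local condition at the prime `p` -/
  expt : ℕ → ℕ
  /-- the allowed residues `Σ_p` of `(A, B)` modulo `p ^ k_p` -/
  residues : (p : ℕ) → Set (ZMod (p ^ expt p) × ZMod (p ^ expt p))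
  /-- condition at infinity: curves of positive discriminant are allowed -/
  allowPos : Prop
  /-- condition at infinity: curves of negative discriminant are allowed -/
  allowNeg : Prop

namespace CongruenceFamily

/-- Membership of the curve `E_{A,B}` (in its unique model with `p⁴ ∤ A` or `p⁶ ∤ B`,
`Literature.NumberTheory.EllipticCurves.IsInHeightFamily`) in the family `F`: the residue condition at every prime and the sign
condition at infinity on `Δ(A, B) = -4A³ - 27B²` (source §3, p. 14, `E^{I,J} ∈ F_Σ` iff
`(I, J) ∈ Σ_p` for all `p` and `(I, J) ∈ Σ_∞`).
[cite: BhargavaShankarTernary2015, §3 (arXiv v2 p. 14)] -/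
def Mem (F : CongruenceFamily) (AB : ℤ × ℤ) : Prop :=
  IsInHeightFamily AB ∧
    (∀ p : ℕ, p.Prime →
      ((AB.1 : ZMod (p ^ F.expt p)), (AB.2 : ZMod (p ^ F.expt p))) ∈ F.residues p) ∧
    (0 < -(4 * AB.1 ^ 3 + 27 * AB.2 ^ 2) → F.allowPos) ∧
    (-(4 * AB.1 ^ 3 + 27 * AB.2 ^ 2) < 0 → F.allowNeg)

/-- `F` is **large** (source §3, p. 14): "for all but finitely many primes `p`, the set `Inv_p(F)`"
(the `p`-adic closure of the set of invariants of the members of `F`) "contains all pairs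
`(I, J) ∈ ℤ_p × ℤ_p` such that `p² ∤ Δ(I, J)`", where `Δ(I, J) = (4I³ - J²)/27 = -4A³ - 27B²`.
Transcribed literally as density of the members of `F` in every residue class: for every integer pair
`(a, b)` with `p² ∤ 4a³ + 27b²` and every `k` there is a member `(A, B)` of `F` congruent to
`(a, b)` modulo `p ^ k` (integer pairs being dense in `ℤ_p²`, this is the printed condition).
Examples (source, loc. cit.): all curves; finitely many congruence conditions; semistable curves.
[cite: BhargavaShankarTernary2015, §3 (definition of a large family; arXiv v2 p. 14)] -/
def IsLarge (F : CongruenceFamily) : Prop :=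
  ∃ p₀ : ℕ, ∀ p : ℕ, p₀ ≤ p → p.Prime → ∀ (a b : ℤ) (k : ℕ),
    ¬ ((p : ℤ) ^ 2 ∣ 4 * a ^ 3 + 27 * b ^ 2) →
      ∃ AB : ℤ × ℤ, F.Mem AB ∧ AB.1 ≡ a [ZMOD (p : ℤ) ^ k] ∧ AB.2 ≡ b [ZMOD (p : ℤ) ^ k]

end CongruenceFamily

/-- Membership in the union of finitely many congruence families (the source's §4.1 family is the
union of its two sign pieces; §4.2 speaks of "an explicit union `F` of positive proportion large
families"). [cite: BhargavaShankarTernary2015, §4.1–4.2 (arXiv v2)] -/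
def UnionMem {n : ℕ} (F : Fin n → CongruenceFamily) (AB : ℤ × ℤ) : Prop :=
  ∃ i, (F i).Mem AB

/-- **Thm 27 of the source (average size of the `3`-Selmer group in large families)**: "When elliptic
curves `E` in any large family are ordered by height, the average size of the `3`-Selmer group
`S₃(E)` is `4`." Vendored in the weaker `limsup` form and for the (clopen) congruence families of this
file: for every large `F` and every `ε > 0`, eventually in `X` the average of `#Sel^(3)(E_{A,B}/ℚ)`
(`Nat.card` of `WeierstrassCurve.selmerGroup 3`) over the members of `F` of naive height `< X` is at
most `4 + ε`. (The source's height `H' = max(|I|³, J²/4) = (27/4)·H` induces the same ordering, and the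
real parameter `X` specialises to the natural numbers used by `Literature.NumberTheory.EllipticCurves.heightFamilyBelow`.)
Bhargava–Skinner–Zhang, arXiv:1407.1826, Thm 13 is the same statement for `p = 2, 3, 5`.
[cite: BhargavaShankarTernary2015, Thm 27 (arXiv v2 numbering; = v1 Thm 26, "at most 4")] -/
def heightAverageOn_card_selmerThree_le_four : Prop :=
  ∀ F : CongruenceFamily, F.IsLarge → ∀ ε : ℝ, 0 < ε → ∀ᶠ X : ℕ in atTop,
    heightAverageOn F.Mem (fun AB ↦ (Nat.card ((shortWeierstrass AB).selmerGroup 3) : ℝ)) X ≤ 4 + ε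

/-- **The root-number family of §4.1 of the source** (two paragraphs after the proof of Thm 41, with
Thm 37 for the count): "We now construct an explicit positive proportion large family `F` of elliptic
curves for which exactly `50%` of the curves have root number equal to `1`" — namely the curves `E`
such that `E` and its twist `E₋₁` both have additive reduction at `2` with `2`-adic unit
`j`-invariants, `E` has squarefree discriminant away from `2`, and `Δ'(E) = |Δ(E)/2^{v₂(Δ(E))}| ≡ 1
(mod 4)`; "if `E ∈ F`, then the twist `E₋₁` of `E` by `-1` is also clearly in `F`", "`ω(E) = -ω(E₋₁)`
for all `E ∈ F`" (local root numbers at odd multiplicative primes and S. Wong, Compositio Math. 127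
(2001), Lemma 12 at `p = 2`), and "the height of an elliptic curve also remains the same under
twisting by `-1`". For `E = E_{A,B}` the twist by `-1` is `E_{A,-B}` (`-y² = x³ + Ax + B`,
`x ↦ -x`). Vendored as an existence statement: there are finitely many pairwise disjoint large
congruence families (the sign pieces `F ∩ {Δ > 0}`, `F ∩ {Δ < 0}` of the source's `F`, whose local
conditions are congruence conditions modulo fixed powers of each prime) whose union `U` is stable
under `(A, B) ↦ (A, -B)`, on which this involution reverses the root number
(`WeierstrassCurve.rootNumber`), and which contains a positive proportion of all curves ordered by
naive height (`Literature.NumberTheory.EllipticCurves.heightProportion`, eventually `≥ c > 0`). The careful treatment of the primes `2`,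
`3` is that of Bhargava–Shankar, arXiv:1312.7859, §5 (cf. Bhargava–Skinner–Zhang Thm 16).
[cite: BhargavaShankarTernary2015, §4.1 (construction of F) and Thm 37 (arXiv v2 numbering)]
[cite: BhargavaShankar5Selmer2013, §5] -/
def exists_isLarge_rootNumber_twist_family : Prop :=
  ∃ (n : ℕ) (F : Fin n → CongruenceFamily), (∀ i, (F i).IsLarge) ∧
    (∀ i j, i ≠ j → ∀ AB, (F i).Mem AB → ¬ (F j).Mem AB) ∧
    (∀ AB, UnionMem F AB → UnionMem F (AB.1, -AB.2)) ∧
    (∀ AB, UnionMem F AB →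
      (shortWeierstrass (AB.1, -AB.2)).rootNumber = -(shortWeierstrass AB).rootNumber) ∧
    ∃ c : ℝ, 0 < c ∧ ∀ᶠ X : ℕ in atTop, c ≤ heightProportion (UnionMem F) X

end Families

/-! ### Lemma 19 of the source, as used in the proof of Thm 41: rational `3`-torsion is negligible
(proved) -/

section ThreeTorsion


/-- A non-trivial rational `3`-torsion point `P = (x, y)` on `E_{A,B}` gives a rational root `x` of
the `3`-division polynomial `Ψ₃ = 3x⁴ + 6Ax² + 12Bx - A²` (with `y² = x³ + Ax + B`): `P` is not
`2`-torsion (else `3P = P ≠ O`), so `3P = O ↔ Ψ₃(x) = 0` by the tree's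
`WeierstrassCurve.three_smul_some_eq_zero_iff` (`DivisionPolynomialTorsion.lean`, Silverman,
*AEC*, Exercise 3.7, proved there from Mathlib's group law). [cite: SilvermanAEC2009, Exercise 3.7] -/
theorem exists_root_of_torsionBy_three_ne_bot {AB : ℤ × ℤ}
    (h : (shortWeierstrass AB).toAffine.Point[(3 : ℤ)] ≠ ⊥) :
    ∃ x y : ℚ, 3 * x ^ 4 + 6 * AB.1 * x ^ 2 + 12 * AB.2 * x - (AB.1 : ℚ) ^ 2 = 0 ∧
      y ^ 2 = x ^ 3 + AB.1 * x + AB.2 := by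
  obtain ⟨P, hP3, hP0⟩ : ∃ P : (shortWeierstrass AB).toAffine.Point,
      P ∈ (shortWeierstrass AB).toAffine.Point[(3 : ℤ)] ∧ P ≠ 0 := by
    by_contra hc
    push Not at hc
    exact h ((AddSubgroup.eq_bot_iff_forall _).mpr hc)
  have hP3' : (3 : ℤ) • P = 0 := (Submodule.mem_torsionBy_iff _ _).mp hP3
  rcases P with _ | ⟨x, y, hns⟩
  · exact (hP0 rfl).elim
  · have hy : y ≠ (shortWeierstrass AB).toAffine.negY x y := by
      intro hyy
      have h2 : (Affine.Point.some x y hns : (shortWeierstrass AB).toAffine.Point) +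
          Affine.Point.some x y hns = 0 := by
        nth_rewrite 2 [show (Affine.Point.some x y hns : (shortWeierstrass AB).toAffine.Point) =
          -Affine.Point.some x y hns by rw [Affine.Point.neg_some]; congr]
        exact add_neg_cancel _
      apply hP0
      have : (3 : ℤ) • (Affine.Point.some x y hns : (shortWeierstrass AB).toAffine.Point) =
          Affine.Point.some x y hns + Affine.Point.some x y hns + Affine.Point.some x y hns := by
        rw [show (3 : ℤ) = 1 + 1 + 1 by norm_num, add_zsmul, add_zsmul, one_zsmul]
      rw [this, h2, zero_add] at hP3'
      exact hP3'
    have hΨ := (three_smul_some_eq_zero_iff hns hy).mp hP3'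
    rw [ψ_three, evalEval_C] at hΨ
    refine ⟨x, y, ?_, ?_⟩
    · have e : (shortWeierstrass AB).Ψ₃.eval x =
          3 * x ^ 4 + 6 * AB.1 * x ^ 2 + 12 * AB.2 * x - (AB.1 : ℚ) ^ 2 := by
        simp only [Ψ₃, b₂, b₄, b₆, b₈, shortWeierstrass, eval_add, eval_mul, eval_pow, eval_C,
          eval_X, eval_ofNat]
        ring
      rw [← e]; exact hΨ
    · have heq := (Affine.equation_iff ..).mp hns.left
      simp only [shortWeierstrass] at heq
      linear_combination heq

/-- A rational root `x = r/s` of `3x⁴ + 6Ax² + 12Bx - A²` (`A, B ∈ ℤ`) has `s ∣ 3` (clear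
denominators: `s ∣ 3r⁴` with `gcd(r, s) = 1`), so `m = 3x ∈ ℤ` and
`m⁴ + 18Am² + 108Bm - 27A² = 0` (elementary; the integrality step of the count of curves with a
`3`-torsion point, cf. Harron–Snowden, arXiv:1311.4920, §1.4). [folklore] -/
theorem exists_int_eq_three_mul_of_root {A B : ℤ} {x : ℚ}
    (h : 3 * x ^ 4 + 6 * A * x ^ 2 + 12 * B * x - (A : ℚ) ^ 2 = 0) :
    ∃ m : ℤ, (m : ℚ) = 3 * x ∧ m ^ 4 + 18 * A * m ^ 2 + 108 * B * m - 27 * A ^ 2 = 0 := by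
  set r : ℤ := x.num with hr
  set s : ℤ := (x.den : ℤ) with hs
  have hs0 : (s : ℚ) ≠ 0 := by
    rw [hs]; exact_mod_cast x.den_pos.ne'
  have hx : x = r / s := by
    rw [hr, hs, Int.cast_natCast, Rat.num_div_den]
  have key : 3 * r ^ 4 + 6 * A * r ^ 2 * s ^ 2 + 12 * B * r * s ^ 3 - A ^ 2 * s ^ 4 = 0 := by
    have e : ((3 * r ^ 4 + 6 * A * r ^ 2 * s ^ 2 + 12 * B * r * s ^ 3 - A ^ 2 * s ^ 4 : ℤ) : ℚ) =
        (3 * x ^ 4 + 6 * A * x ^ 2 + 12 * B * x - (A : ℚ) ^ 2) * (s : ℚ) ^ 4 := by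
      rw [hx]; push_cast; field_simp
    rw [h, zero_mul] at e
    exact_mod_cast e
  have hdvd : s ∣ 3 * r ^ 4 :=
    ⟨-(6 * A * r ^ 2 * s + 12 * B * r * s ^ 2 - A ^ 2 * s ^ 3), by linear_combination key⟩
  have hcop : IsCoprime s (r ^ 4) := by
    refine IsCoprime.pow_right ?_
    rw [hs, hr, Int.isCoprime_iff_gcd_eq_one, Int.gcd_comm, Int.gcd_eq_natAbs, Int.natAbs_natCast]
    exact x.reduced
  obtain ⟨t, ht⟩ := hcop.dvd_of_dvd_mul_right hdvd
  refine ⟨t * r, ?_, ?_⟩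
  · have h3 : (3 : ℚ) = (s : ℚ) * t := by exact_mod_cast ht
    rw [hx, h3]; push_cast; field_simp
  · have hm : (t : ℚ) * r = 3 * x := by
      have h3 : (3 : ℚ) = (s : ℚ) * t := by exact_mod_cast ht
      rw [hx, h3]; field_simp
    have e : (((t * r) ^ 4 + 18 * A * (t * r) ^ 2 + 108 * B * (t * r) - 27 * A ^ 2 : ℤ) : ℚ) =
        27 * (3 * x ^ 4 + 6 * A * x ^ 2 + 12 * B * x - (A : ℚ) ^ 2) := by
      push_cast; rw [hm]; ring
    rw [h, mul_zero] at e
    exact_mod_cast e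

/-- The integer `m = 3x(P)` attached to a `3`-torsion point of a curve of naive height `< X`
(`4|A|³ < X`, `27B² < X`) satisfies `m⁶ ≤ 39366·X = (54³/4)·X`: from
`m⁴ = 27A² - 18Am² - 108Bm ≤ 27A² + 18|A|m² + 108|B||m|` one of `m² ≤ 9|A|`, `m² ≤ 54|A|`,
`|m|³ < 324|B|` holds (elementary). [folklore] -/
theorem pow_six_le_of_root {A B m : ℤ} {X : ℕ} (hA : 4 * |A| ^ 3 < X) (hB : 27 * B ^ 2 < X)
    (hm : m ^ 4 + 18 * A * m ^ 2 + 108 * B * m - 27 * A ^ 2 = 0) : m ^ 6 ≤ 39366 * X := by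
  have hm2 : 0 ≤ m ^ 2 := sq_nonneg m
  have hA0 : 0 ≤ |A| := abs_nonneg A
  have hB0 : 0 ≤ |B| := abs_nonneg B
  have hmabs : 0 ≤ |m| := abs_nonneg m
  have hX : (0 : ℤ) ≤ X := by positivity
  have h4 : m ^ 4 ≤ 27 * A ^ 2 + 18 * |A| * m ^ 2 + 108 * |B| * |m| := by
    have t1 : -(18 * A * m ^ 2) ≤ 18 * |A| * m ^ 2 := by
      have : -A ≤ |A| := neg_le_abs A
      nlinarith
    have t2 : -(108 * B * m) ≤ 108 * |B| * |m| := by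
      have : -(B * m) ≤ |B * m| := neg_le_abs _
      rw [abs_mul] at this
      linarith
    linarith
  have hm4abs : |m| ^ 4 = m ^ 4 := by rw [pow_abs, abs_of_nonneg (by positivity)]
  have hm2abs : |m| ^ 2 = m ^ 2 := sq_abs m
  have hA2 : |A| ^ 2 = A ^ 2 := sq_abs A
  have hB2 : |B| ^ 2 = B ^ 2 := sq_abs B
  rcases le_or_gt (m ^ 4) (81 * A ^ 2) with h1 | h1
  · -- `m² ≤ 9|A|`, so `m⁶ ≤ 729 |A|³`
    have hle : m ^ 2 ≤ 9 * |A| := by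
      have : (m ^ 2) ^ 2 ≤ (9 * |A|) ^ 2 := by nlinarith
      exact (pow_le_pow_iff_left₀ hm2 (by positivity) two_ne_zero).mp this
    have : m ^ 6 ≤ (9 * |A|) ^ 3 := by
      rw [show m ^ 6 = (m ^ 2) ^ 3 by ring]
      exact pow_le_pow_left₀ hm2 hle 3
    nlinarith
  rcases le_or_gt (m ^ 4) (54 * |A| * m ^ 2) with h2 | h2
  · rcases eq_or_ne m 0 with rfl | hm0
    · simp
    have hpos : 0 < m ^ 2 := by positivity
    have hle : m ^ 2 ≤ 54 * |A| := by
      have : m ^ 2 * m ^ 2 ≤ 54 * |A| * m ^ 2 := by nlinarith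
      exact le_of_mul_le_mul_right this hpos
    have : m ^ 6 ≤ (54 * |A|) ^ 3 := by
      rw [show m ^ 6 = (m ^ 2) ^ 3 by ring]
      exact pow_le_pow_left₀ hm2 hle 3
    nlinarith
  · -- both previous terms are `< m⁴ / 3`, so `m⁴ < 324 |B| |m|`
    have h3 : m ^ 4 < 324 * |B| * |m| := by nlinarith
    rcases eq_or_ne m 0 with rfl | hm0
    · simp
    have hpos : 0 < |m| := abs_pos.mpr hm0
    have hle : |m| ^ 3 < 324 * |B| := by
      have : |m| ^ 3 * |m| < 324 * |B| * |m| := by rw [← pow_succ, hm4abs]; exact h3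
      exact lt_of_mul_lt_mul_right this hmabs
    have : m ^ 6 < (324 * |B|) ^ 2 := by
      rw [show m ^ 6 = (|m| ^ 3) ^ 2 by rw [← pow_mul, pow_abs, abs_of_nonneg (by positivity : (0:ℤ) ≤ m ^ 6)]]
      exact pow_lt_pow_left₀ hle (by positivity) two_ne_zero
    nlinarith



/-- A finite set of integers of absolute value `≤ R` has at most `2R + 1` elements (it lies in
`[-⌊R⌋, ⌊R⌋]`). [folklore] -/
theorem card_le_two_mul_add_one_of_abs_le (s : Finset ℤ) {R : ℝ} (hR : 0 ≤ R)
    (h : ∀ a ∈ s, (|a| : ℝ) ≤ R) : (s.card : ℝ) ≤ 2 * R + 1 := by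
  have hsub : s ⊆ Finset.Icc (-(⌊R⌋₊ : ℤ)) ⌊R⌋₊ := by
    intro a ha
    have hle : |a| ≤ (⌊R⌋₊ : ℤ) := by
      have h1 : (a.natAbs : ℝ) ≤ R := by
        rw [Nat.cast_natAbs, Int.cast_abs]; exact h a ha
      have h2 : a.natAbs ≤ ⌊R⌋₊ := Nat.le_floor h1
      rw [← Int.natCast_natAbs]; exact_mod_cast h2
    exact Finset.mem_Icc.mpr (abs_le.mp hle)
  have hcard := Finset.card_le_card hsub
  rw [Int.card_Icc] at hcard
  have hfl : (⌊R⌋₊ : ℝ) ≤ R := Nat.floor_le hR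
  have : (s.card : ℝ) ≤ ((⌊R⌋₊ : ℤ) + 1 - -(⌊R⌋₊ : ℤ)).toNat := by exact_mod_cast hcard
  rw [show ((⌊R⌋₊ : ℤ) + 1 - -(⌊R⌋₊ : ℤ)) = ((2 * ⌊R⌋₊ + 1 : ℕ) : ℤ) by push_cast; ring,
    Int.toNat_natCast] at this
  push_cast at this
  linarith

/-- `y ^ k ≤ Z` implies `y ≤ Z ^ (1/k)` for real `y ≥ 0` (monotonicity of `t ↦ t^{1/k}`). [folklore] -/
theorem le_rpow_inv_of_pow_le {y Z : ℝ} (hy : 0 ≤ y) {k : ℕ} (hk : k ≠ 0) (h : y ^ k ≤ Z) :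
    y ≤ Z ^ ((k : ℝ)⁻¹) := by
  have hZ : 0 ≤ Z := le_trans (by positivity) h
  calc y = (y ^ k) ^ ((k : ℝ)⁻¹) := (Real.pow_rpow_inv_natCast hy hk).symm
    _ ≤ Z ^ ((k : ℝ)⁻¹) := Real.rpow_le_rpow (by positivity) h (by positivity)

/-- `y ^ k < Z` implies `y < Z ^ (1/k)` for real `y ≥ 0`. [folklore] -/
theorem lt_rpow_inv_of_pow_lt {y Z : ℝ} (hy : 0 ≤ y) {k : ℕ} (hk : k ≠ 0) (h : y ^ k < Z) :
    y < Z ^ ((k : ℝ)⁻¹) := by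
  calc y = (y ^ k) ^ ((k : ℝ)⁻¹) := (Real.pow_rpow_inv_natCast hy hk).symm
    _ < Z ^ ((k : ℝ)⁻¹) := Real.rpow_lt_rpow (by positivity) h (by positivity)


/-- **The curves with a rational point of order `3` are negligible, quantitatively** (the source's
"Lemma 19 implies that the number of elliptic curves over `ℚ` that have a nontrivial rational
`3`-torsion point is negligible", proof of Thm 41; here by the elementary count of Harron–Snowden,
arXiv:1311.4920, §1.4 rather than by counting ternary cubic forms with a stabiliser): among the
curves `E_{A,B}` of naive height `< X` (`X ≥ 1`), at most `40·X^{1/2} + 2` have `E(ℚ)[3] ≠ 0`.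
Indeed such a curve with `A ≠ 0` is determined by `(A, m)`, `m = 3x(P) ≠ 0`
(`108Bm = 27A² - m⁴ - 18Am²`), with `|A| < X^{1/3}` and `|m| ≤ 6X^{1/6}`, and the curves with
`A = 0` are at most `2X^{1/2} + 1` in number; the total is `(2X^{1/3} + 1)(12X^{1/6} + 1) +
2X^{1/2} + 1 ≤ 40X^{1/2} + 2`. (The true order is `X^{1/3}`, Harron–Snowden Thm 1.)
[cite: BhargavaShankarTernary2015, proof of Thm 41 (arXiv v2 numbering), first paragraph] -/
theorem card_filter_torsionBy_three_ne_bot_le (X : ℕ) (hX : 1 ≤ X) :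
    ((((heightFamilyBelow X).filter
        (fun AB ↦ (shortWeierstrass AB).toAffine.Point[(3 : ℤ)] ≠ ⊥)).card : ℕ) : ℝ) ≤
      40 * (X : ℝ) ^ ((2 : ℝ)⁻¹) + 2 := by
  set Bad := (heightFamilyBelow X).filter
    (fun AB ↦ (shortWeierstrass AB).toAffine.Point[(3 : ℤ)] ≠ ⊥) with hBad
  have hX1 : (1 : ℝ) ≤ X := by exact_mod_cast hX
  -- height bounds for members
  have hbounds : ∀ AB ∈ Bad, 4 * |AB.1| ^ 3 < (X : ℤ) ∧ 27 * AB.2 ^ 2 < (X : ℤ) := by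
    intro AB hAB
    have hH := ((mem_heightFamilyBelow_iff AB X).mp (Finset.mem_filter.mp hAB).1).2
    simp only [naiveHeight, max_lt_iff] at hH
    exact hH
  -- the root `m` attached to a bad pair with `A ≠ 0`
  have hroot : ∀ AB ∈ Bad, ∃ m : ℤ,
      m ^ 4 + 18 * AB.1 * m ^ 2 + 108 * AB.2 * m - 27 * AB.1 ^ 2 = 0 ∧ m ^ 6 ≤ 39366 * X := by
    intro AB hAB
    obtain ⟨x, y, hx, -⟩ := exists_root_of_torsionBy_three_ne_bot (Finset.mem_filter.mp hAB).2
    obtain ⟨m, -, hm⟩ := exists_int_eq_three_mul_of_root hx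
    exact ⟨m, hm, pow_six_le_of_root (hbounds AB hAB).1 (hbounds AB hAB).2 hm⟩
  choose! mOf hmOf using hroot
  -- split `Bad` by `A = 0`
  have hsplit := Finset.card_filter_add_card_filter_not (s := Bad) (fun AB ↦ AB.1 = 0)
  -- the `A = 0` part injects into `{B : |B| ≤ X^{1/2}}` via `AB ↦ B`
  have h0 : (((Bad.filter (fun AB ↦ AB.1 = 0)).card : ℕ) : ℝ) ≤ 2 * (X : ℝ) ^ ((2 : ℝ)⁻¹) + 1 := by
    have hinj : Set.InjOn (fun AB : ℤ × ℤ ↦ AB.2) ↑(Bad.filter (fun AB ↦ AB.1 = 0)) := by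
      intro AB hAB AB' hAB' h
      simp only [Finset.coe_filter, Set.mem_setOf_eq] at hAB hAB'
      exact Prod.ext (hAB.2.trans hAB'.2.symm) h
    rw [← Finset.card_image_of_injOn hinj]
    refine card_le_two_mul_add_one_of_abs_le _ (by positivity) fun b hb ↦ ?_
    obtain ⟨AB, hAB, rfl⟩ := Finset.mem_image.mp hb
    have hB := (hbounds AB (Finset.mem_filter.mp hAB).1).2
    have hB' : |(AB.2 : ℝ)| ^ 2 < X := by
      have : ((27 * AB.2 ^ 2 : ℤ) : ℝ) < X := by exact_mod_cast hB
      push_cast at this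
      rw [sq_abs]; nlinarith [sq_nonneg (AB.2 : ℝ)]
    have := lt_rpow_inv_of_pow_lt (abs_nonneg _) two_ne_zero hB'
    rw [Nat.cast_ofNat] at this
    exact this.le
  -- the `A ≠ 0` part injects into `{|A| ≤ X^{1/3}} × {|m| ≤ 6 X^{1/6}}` via `AB ↦ (A, m)`
  have h1 : (((Bad.filter (fun AB ↦ ¬ AB.1 = 0)).card : ℕ) : ℝ) ≤
      (2 * (X : ℝ) ^ ((3 : ℝ)⁻¹) + 1) * (2 * (6 * (X : ℝ) ^ ((6 : ℝ)⁻¹)) + 1) := by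
    have hinj : Set.InjOn (fun AB : ℤ × ℤ ↦ (AB.1, mOf AB)) ↑(Bad.filter (fun AB ↦ ¬ AB.1 = 0)) := by
      intro AB hAB AB' hAB' h
      simp only [Finset.coe_filter, Set.mem_setOf_eq] at hAB hAB'
      obtain ⟨hA, hm⟩ := Prod.mk.inj h
      have e1 := (hmOf AB hAB.1).1
      have e2 := (hmOf AB' hAB'.1).1
      rw [← hm, ← hA] at e2
      have hm0 : mOf AB ≠ 0 := by
        intro h0
        rw [h0] at e1
        have : AB.1 ^ 2 = 0 := by linarith
        exact hAB.2 (pow_eq_zero_iff two_ne_zero |>.mp this)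
      have : 108 * mOf AB * (AB.2 - AB'.2) = 0 := by linear_combination e1 - e2
      rcases mul_eq_zero.mp this with h' | h'
      · exact (hm0 (by simpa using h')).elim
      · exact Prod.ext hA (sub_eq_zero.mp h')
    rw [← Finset.card_image_of_injOn hinj]
    have hsub : (Bad.filter (fun AB ↦ ¬ AB.1 = 0)).image (fun AB : ℤ × ℤ ↦ (AB.1, mOf AB)) ⊆
        ((Bad.filter (fun AB ↦ ¬ AB.1 = 0)).image Prod.fst) ×ˢ
          ((Bad.filter (fun AB ↦ ¬ AB.1 = 0)).image mOf) := by
      intro q hq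
      obtain ⟨AB, hAB, rfl⟩ := Finset.mem_image.mp hq
      exact Finset.mem_product.mpr
        ⟨Finset.mem_image.mpr ⟨AB, hAB, rfl⟩, Finset.mem_image.mpr ⟨AB, hAB, rfl⟩⟩
    have hnat := (Finset.card_le_card hsub).trans (Finset.card_product _ _).le
    have hreal : (((Bad.filter (fun AB ↦ ¬ AB.1 = 0)).image
        (fun AB : ℤ × ℤ ↦ (AB.1, mOf AB))).card : ℝ) ≤
        (((Bad.filter (fun AB ↦ ¬ AB.1 = 0)).image Prod.fst).card : ℝ) *
          (((Bad.filter (fun AB ↦ ¬ AB.1 = 0)).image mOf).card : ℝ) := by exact_mod_cast hnat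
    refine hreal.trans (mul_le_mul ?_ ?_ (by positivity) (by positivity))
    · refine card_le_two_mul_add_one_of_abs_le _ (by positivity) fun a ha ↦ ?_
      obtain ⟨AB, hAB, rfl⟩ := Finset.mem_image.mp ha
      have hA := (hbounds AB (Finset.mem_filter.mp hAB).1).1
      have hA' : |(AB.1 : ℝ)| ^ 3 < X := by
        have : ((4 * |AB.1| ^ 3 : ℤ) : ℝ) < X := by exact_mod_cast hA
        push_cast at this
        nlinarith [pow_nonneg (abs_nonneg (AB.1 : ℝ)) 3]
      have := lt_rpow_inv_of_pow_lt (abs_nonneg _) three_ne_zero hA'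
      rw [Nat.cast_ofNat] at this
      exact this.le
    · refine card_le_two_mul_add_one_of_abs_le _ (by positivity) fun m hm ↦ ?_
      obtain ⟨AB, hAB, rfl⟩ := Finset.mem_image.mp hm
      have h6 := (hmOf AB (Finset.mem_filter.mp hAB).1).2
      have h6' : (|(mOf AB : ℝ)| / 6) ^ 6 ≤ X := by
        have : ((mOf AB : ℤ) : ℝ) ^ 6 ≤ 39366 * X := by exact_mod_cast h6
        rw [div_pow, pow_abs, abs_of_nonneg (by positivity : (0 : ℝ) ≤ (mOf AB : ℝ) ^ 6)]
        rw [div_le_iff₀ (by norm_num)]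
        nlinarith
      have := le_rpow_inv_of_pow_le (by positivity) (by norm_num : (6 : ℕ) ≠ 0) h6'
      rw [Nat.cast_ofNat, div_le_iff₀ (by norm_num)] at this
      linarith
  -- powers of `X ≥ 1` compare
  have hp3 : (X : ℝ) ^ ((3 : ℝ)⁻¹) ≤ (X : ℝ) ^ ((2 : ℝ)⁻¹) :=
    Real.rpow_le_rpow_of_exponent_le hX1 (by norm_num)
  have hp6 : (X : ℝ) ^ ((6 : ℝ)⁻¹) ≤ (X : ℝ) ^ ((2 : ℝ)⁻¹) :=
    Real.rpow_le_rpow_of_exponent_le hX1 (by norm_num)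
  have hp36 : (X : ℝ) ^ ((3 : ℝ)⁻¹) * (X : ℝ) ^ ((6 : ℝ)⁻¹) = (X : ℝ) ^ ((2 : ℝ)⁻¹) := by
    rw [← Real.rpow_add (by positivity)]; norm_num
  have hp0 : (0 : ℝ) ≤ (X : ℝ) ^ ((6 : ℝ)⁻¹) := by positivity
  have hp0' : (0 : ℝ) ≤ (X : ℝ) ^ ((3 : ℝ)⁻¹) := by positivity
  have hone : (1 : ℝ) ≤ (X : ℝ) ^ ((2 : ℝ)⁻¹) := Real.one_le_rpow hX1 (by norm_num)
  have hcardR : (Bad.card : ℝ) = ((Bad.filter (fun AB ↦ AB.1 = 0)).card : ℕ) +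
      ((Bad.filter (fun AB ↦ ¬ AB.1 = 0)).card : ℕ) := by exact_mod_cast hsplit.symm
  rw [hcardR]
  nlinarith [h0, h1, hp3, hp6, hp36, hp0, hp0', hone]

/-- `∑_{m=2}^{N} 1/m⁴ ≤ 1/4 - 1/(4N)` for `N ≥ 1` (induction; `4N ≤ (N+1)³`). [folklore] -/
theorem sum_Ioc_one_div_pow_four_le (N : ℕ) (hN : 1 ≤ N) :
    ∑ m ∈ Finset.Ioc 1 N, (1 : ℝ) / (m : ℝ) ^ 4 ≤ 1 / 4 - 1 / (4 * N) := by
  induction N, hN using Nat.le_induction with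
  | base => simp
  | succ N hN ih =>
    rw [Finset.sum_Ioc_succ_top (by omega), Nat.cast_succ]
    have hN1 : (1 : ℝ) ≤ N := by exact_mod_cast hN
    have key : (1 : ℝ) / ((N : ℝ) + 1) ^ 4 ≤ 1 / (4 * N) - 1 / (4 * (N + 1)) := by
      rw [div_sub_div _ _ (by positivity) (by positivity), div_le_div_iff₀ (by positivity) (by positivity)]
      nlinarith [sq_nonneg ((N : ℝ) - 1), sq_nonneg ((N : ℝ) + 1)]
    linarith

/-- At most `N/4` of the integers `1 ≤ A ≤ N` are divisible by some `m⁴` with `2 ≤ m ≤ N` (union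
bound: `∑_{m ≥ 2} ⌊N/m⁴⌋ ≤ N ∑_{m ≥ 2} m⁻⁴ ≤ N/4`). [folklore] -/
theorem card_filter_exists_pow_four_dvd_le (N : ℕ) :
    ((((Finset.Ioc 0 N).filter (fun A ↦ ∃ m ∈ Finset.Ioc 1 N, m ^ 4 ∣ A)).card : ℕ) : ℝ) ≤
      (N : ℝ) / 4 := by
  rcases Nat.eq_zero_or_pos N with rfl | hN
  · simp
  have hsub : (Finset.Ioc 0 N).filter (fun A ↦ ∃ m ∈ Finset.Ioc 1 N, m ^ 4 ∣ A) ⊆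
      (Finset.Ioc 1 N).biUnion (fun m ↦ (Finset.Ioc 0 N).filter (fun A ↦ m ^ 4 ∣ A)) := by
    intro A hA
    simp only [Finset.mem_filter, Finset.mem_biUnion] at hA ⊢
    obtain ⟨hA0, m, hm, hdvd⟩ := hA
    exact ⟨m, hm, hA0, hdvd⟩
  have h1 := (Finset.card_le_card hsub).trans Finset.card_biUnion_le
  have h2 : ∀ m ∈ Finset.Ioc 1 N, ((Finset.Ioc 0 N).filter (fun A ↦ m ^ 4 ∣ A)).card = N / m ^ 4 :=
    fun m _ ↦ Nat.Ioc_filter_dvd_card_eq_div N (m ^ 4)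
  rw [Finset.sum_congr rfl h2] at h1
  have h3 : (((Finset.Ioc 0 N).filter (fun A ↦ ∃ m ∈ Finset.Ioc 1 N, m ^ 4 ∣ A)).card : ℝ) ≤
      ∑ m ∈ Finset.Ioc 1 N, ((N / m ^ 4 : ℕ) : ℝ) := by exact_mod_cast h1
  refine h3.trans ?_
  calc ∑ m ∈ Finset.Ioc 1 N, ((N / m ^ 4 : ℕ) : ℝ)
      ≤ ∑ m ∈ Finset.Ioc 1 N, (N : ℝ) * (1 / (m : ℝ) ^ 4) := by
        refine Finset.sum_le_sum fun m hm ↦ ?_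
        have hm0 : (0 : ℝ) < (m : ℝ) ^ 4 := by
          have : 1 < m := (Finset.mem_Ioc.mp hm).1
          positivity
        rw [mul_one_div, le_div_iff₀ hm0]
        exact_mod_cast Nat.div_mul_le_self N (m ^ 4)
    _ = (N : ℝ) * ∑ m ∈ Finset.Ioc 1 N, 1 / (m : ℝ) ^ 4 := by rw [Finset.mul_sum]
    _ ≤ (N : ℝ) * (1 / 4 - 1 / (4 * N)) :=
        mul_le_mul_of_nonneg_left (sum_Ioc_one_div_pow_four_le N hN) (Nat.cast_nonneg N)
    _ ≤ (N : ℝ) / 4 := by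
        have : (0 : ℝ) ≤ (N : ℝ) * (1 / (4 * N)) := by positivity
        linarith

/-- **Lower bound for the number of curves of naive height `< X`**: at least
`(3/4)·⌊(X/5)^{1/3}⌋·⌊(X/28)^{1/2}⌋` (order `X^{5/6}`; the source's Thm 37 / Brumer give the
asymptotic `c·X^{5/6}`): the pairs `(A, B)` with `1 ≤ A ≤ (X/5)^{1/3}` free of fourth powers
(at least `3/4` of them, previous lemma) and `1 ≤ B ≤ (X/28)^{1/2}` are in the family
(`4A³ + 27B² > 0`; `p⁴ ∤ A`) with `4A³ ≤ 4X/5 < X`, `27B² ≤ 27X/28 < X`.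
[cite: BhargavaShankarTernary2015, Thm 37 (arXiv v2 numbering; only the trivial lower bound is proved here)] -/
theorem card_heightFamilyBelow_ge (X : ℕ) (hX : 1 ≤ X) :
    (3 / 4 : ℝ) * ⌊((X : ℝ) / 5) ^ ((3 : ℝ)⁻¹)⌋₊ * ⌊((X : ℝ) / 28) ^ ((2 : ℝ)⁻¹)⌋₊ ≤
      (heightFamilyBelow X).card := by
  set N := ⌊((X : ℝ) / 5) ^ ((3 : ℝ)⁻¹)⌋₊ with hN
  set M := ⌊((X : ℝ) / 28) ^ ((2 : ℝ)⁻¹)⌋₊ with hM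
  have hX0 : (0 : ℝ) < X := by exact_mod_cast hX
  have hN3 : (N : ℝ) ^ 3 ≤ X / 5 := by
    have h := Nat.floor_le (Real.rpow_nonneg (by positivity : (0 : ℝ) ≤ X / 5) (3 : ℝ)⁻¹)
    calc (N : ℝ) ^ 3 ≤ (((X : ℝ) / 5) ^ ((3 : ℝ)⁻¹)) ^ 3 := pow_le_pow_left₀ (Nat.cast_nonneg _) h 3
      _ = X / 5 := by
        rw [show ((3 : ℝ)⁻¹) = ((3 : ℕ) : ℝ)⁻¹ by norm_num]
        exact Real.rpow_inv_natCast_pow (by positivity) three_ne_zero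
  have hM2 : (M : ℝ) ^ 2 ≤ X / 28 := by
    have h := Nat.floor_le (Real.rpow_nonneg (by positivity : (0 : ℝ) ≤ X / 28) (2 : ℝ)⁻¹)
    calc (M : ℝ) ^ 2 ≤ (((X : ℝ) / 28) ^ ((2 : ℝ)⁻¹)) ^ 2 := pow_le_pow_left₀ (Nat.cast_nonneg _) h 2
      _ = X / 28 := by
        rw [show ((2 : ℝ)⁻¹) = ((2 : ℕ) : ℝ)⁻¹ by norm_num]
        exact Real.rpow_inv_natCast_pow (by positivity) two_ne_zero
  -- the good `A`'s
  set G := (Finset.Ioc 0 N).filter (fun A ↦ ¬ ∃ m ∈ Finset.Ioc 1 N, m ^ 4 ∣ A) with hG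
  have hGcard : (3 / 4 : ℝ) * N ≤ G.card := by
    have hsplit := Finset.card_filter_add_card_filter_not (s := Finset.Ioc 0 N)
      (fun A ↦ ∃ m ∈ Finset.Ioc 1 N, m ^ 4 ∣ A)
    have hbad := card_filter_exists_pow_four_dvd_le N
    have e : (G.card : ℝ) = N - (((Finset.Ioc 0 N).filter
        (fun A ↦ ∃ m ∈ Finset.Ioc 1 N, m ^ 4 ∣ A)).card : ℕ) := by
      rw [hG, eq_sub_iff_add_eq, add_comm]
      exact_mod_cast hsplit.trans (Nat.card_Ioc 0 N)
    rw [e]; linarith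
  -- the injection of the box
  have hinj : Set.InjOn (fun q : ℕ × ℕ ↦ ((q.1 : ℤ), (q.2 : ℤ))) ↑(G ×ˢ Finset.Ioc 0 M) := by
    intro q _ q' _ h
    obtain ⟨h1, h2⟩ := Prod.mk.inj h
    exact Prod.ext (by exact_mod_cast h1) (by exact_mod_cast h2)
  have hsub : (G ×ˢ Finset.Ioc 0 M).image (fun q : ℕ × ℕ ↦ ((q.1 : ℤ), (q.2 : ℤ))) ⊆
      heightFamilyBelow X := by
    intro AB hAB
    obtain ⟨⟨A, B⟩, hq, rfl⟩ := Finset.mem_image.mp hAB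
    obtain ⟨hA, hB⟩ := Finset.mem_product.mp hq
    simp only [hG, Finset.mem_filter, Finset.mem_Ioc] at hA hB
    obtain ⟨⟨hA0, hAN⟩, hgood⟩ := hA
    dsimp only
    rw [mem_heightFamilyBelow_iff]
    refine ⟨⟨by positivity, fun p hp ⟨h4, _⟩ ↦ ?_⟩, ?_⟩
    · have h4' : p ^ 4 ∣ A := by
        have h := h4; dsimp only at h; exact_mod_cast h
      refine hgood ⟨p, ⟨hp.one_lt, ?_⟩, h4'⟩
      exact le_trans (le_trans (Nat.le_self_pow four_ne_zero p) (Nat.le_of_dvd hA0 h4')) hAN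
    · -- the height bound
      simp only [naiveHeight, max_lt_iff]
      have hA3 : (A : ℝ) ^ 3 ≤ (N : ℝ) ^ 3 := pow_le_pow_left₀ (Nat.cast_nonneg _) (by exact_mod_cast hAN) 3
      have hB2 : (B : ℝ) ^ 2 ≤ (M : ℝ) ^ 2 := pow_le_pow_left₀ (Nat.cast_nonneg _) (by exact_mod_cast hB.2) 2
      constructor
      · have : (4 : ℝ) * |((A : ℤ) : ℝ)| ^ 3 < X := by
          rw [Int.cast_natCast, abs_of_nonneg (Nat.cast_nonneg A)]; linarith
        exact_mod_cast this
      · have : (27 : ℝ) * (((B : ℤ) : ℝ)) ^ 2 < X := by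
          rw [Int.cast_natCast]; linarith
        exact_mod_cast this
  have hcard := Finset.card_le_card hsub
  rw [Finset.card_image_of_injOn hinj, Finset.card_product, Nat.card_Ioc, Nat.sub_zero] at hcard
  calc (3 / 4 : ℝ) * N * M ≤ (G.card : ℝ) * M := by
        exact mul_le_mul_of_nonneg_right hGcard (Nat.cast_nonneg M)
    _ ≤ (heightFamilyBelow X).card := by exact_mod_cast hcard



/-- The ratio of the two bounds, `(40X^{1/2} + 2) / ((3/4)((X/5)^{1/3} - 1)((X/28)^{1/2} - 1))`,
tends to `0` as `X → ∞` (it is `(40 + 2X^{-1/2}) / ((3/4)((X/5)^{1/3} - 1)(28^{-1/2} - X^{-1/2}))`,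
a bounded quantity over one tending to `+∞`). [folklore] -/
theorem tendsto_bound_div_lower :
    Tendsto (fun X : ℕ ↦ (40 * (X : ℝ) ^ ((2 : ℝ)⁻¹) + 2) /
      ((3 / 4 : ℝ) * (((X : ℝ) / 5) ^ ((3 : ℝ)⁻¹) - 1) * (((X : ℝ) / 28) ^ ((2 : ℝ)⁻¹) - 1)))
      atTop (𝓝 0) := by
  -- rewrite as `u / v` with `u → 40`, `v → ∞`
  have hx : Tendsto (fun X : ℕ ↦ (X : ℝ)) atTop atTop := tendsto_natCast_atTop_atTop
  have hneg : Tendsto (fun X : ℕ ↦ (X : ℝ) ^ (-(2 : ℝ)⁻¹)) atTop (𝓝 0) :=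
    (tendsto_rpow_neg_atTop (by norm_num : (0 : ℝ) < 2⁻¹)).comp hx
  have hu : Tendsto (fun X : ℕ ↦ (40 : ℝ) + 2 * (X : ℝ) ^ (-(2 : ℝ)⁻¹)) atTop (𝓝 40) := by
    simpa using (hneg.const_mul 2).const_add 40
  have hthird : Tendsto (fun X : ℕ ↦ ((X : ℝ) / 5) ^ ((3 : ℝ)⁻¹) - 1) atTop atTop := by
    refine tendsto_atTop_add_const_right _ _ ?_
    exact (tendsto_rpow_atTop (by norm_num : (0 : ℝ) < 3⁻¹)).comp (hx.atTop_div_const (by norm_num))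
  have hb : Tendsto (fun X : ℕ ↦ (28 : ℝ) ^ (-(2 : ℝ)⁻¹) - (X : ℝ) ^ (-(2 : ℝ)⁻¹)) atTop
      (𝓝 ((28 : ℝ) ^ (-(2 : ℝ)⁻¹))) := by
    simpa using hneg.const_sub ((28 : ℝ) ^ (-(2 : ℝ)⁻¹))
  have hv : Tendsto (fun X : ℕ ↦ (3 / 4 : ℝ) * (((X : ℝ) / 5) ^ ((3 : ℝ)⁻¹) - 1) *
      ((28 : ℝ) ^ (-(2 : ℝ)⁻¹) - (X : ℝ) ^ (-(2 : ℝ)⁻¹))) atTop atTop := by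
    have h1 : Tendsto (fun X : ℕ ↦ (3 / 4 : ℝ) * (((X : ℝ) / 5) ^ ((3 : ℝ)⁻¹) - 1)) atTop atTop :=
      hthird.const_mul_atTop (by norm_num)
    exact h1.atTop_mul_pos (Real.rpow_pos_of_pos (by norm_num) _) hb
  have hlim := hu.div_atTop hv
  refine hlim.congr' ?_
  filter_upwards [eventually_ge_atTop 1] with X hX
  have hX0 : (0 : ℝ) < X := by exact_mod_cast hX
  have hs : (X : ℝ) ^ ((2 : ℝ)⁻¹) ≠ 0 := (Real.rpow_pos_of_pos hX0 _).ne'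
  have e1 : (X : ℝ) ^ (-(2 : ℝ)⁻¹) = ((X : ℝ) ^ ((2 : ℝ)⁻¹))⁻¹ := Real.rpow_neg hX0.le _
  have e2 : ((X : ℝ) / 28) ^ ((2 : ℝ)⁻¹) = (X : ℝ) ^ ((2 : ℝ)⁻¹) * (28 : ℝ) ^ (-(2 : ℝ)⁻¹) := by
    rw [Real.div_rpow hX0.le (by norm_num), Real.rpow_neg (by norm_num), div_eq_mul_inv]
  rw [e2, e1]
  field_simp


/-- **Rational `3`-torsion is negligible (the source's use of its Lemma 19, proved here by an
elementary count).** Source, first lines of the proof of Thm 41: "Lemma 19 implies that the number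
of elliptic curves over `ℚ` that have a nontrivial rational `3`-torsion point is negligible. Thus for
a density of `100%` of elliptic curves `E`, we have `r_p(E) = s_p(E)`", i.e. `t₃(E) = 0`: the
proportion of curves `E_{A,B}` of naive height `< X` with `E(ℚ)[3] = 0` tends to `1`
(`Literature.HasHeightDensity … 1`). Proof: the exceptional proportion is at most
`(40X^{1/2} + 2) / ((3/4)((X/5)^{1/3} - 1)((X/28)^{1/2} - 1)) → 0`
(`card_filter_torsionBy_three_ne_bot_le`, `card_heightFamilyBelow_ge`, `tendsto_bound_div_lower`).
This is also Duke, C. R. Acad. Sci. Paris 325 (1997), Thm 1 (almost all curves have no exceptional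
primes) and Harron–Snowden, *Counting elliptic curves with prescribed torsion*, J. reine angew.
Math. 729 (2017) (arXiv:1311.4920, Corollary 2 of the introduction: "Almost all elliptic curves
over `ℚ` have trivial torsion"); Bhargava–Skinner–Zhang, arXiv:1407.1826, Lemma 20.
[cite: BhargavaShankarTernary2015, proof of Thm 41 with Lemma 19 (arXiv v2 numbering)] -/
theorem hasHeightDensity_torsionBy_three_eq_bot :
    HasHeightDensity (fun AB ↦ (shortWeierstrass AB).toAffine.Point[(3 : ℤ)] = ⊥) 1 := by
  -- notation-free abbreviations
  have hprop : ∀ X : ℕ, heightProportion (fun AB ↦ (shortWeierstrass AB).toAffine.Point[(3 : ℤ)] = ⊥) X =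
      ((((heightFamilyBelow X).filter
        (fun AB ↦ (shortWeierstrass AB).toAffine.Point[(3 : ℤ)] = ⊥)).card : ℕ) : ℝ) /
        (heightFamilyBelow X).card := by
    intro X
    unfold heightProportion heightAverage
    rw [Finset.natCast_card_filter]
  -- the ratio of the exceptional set tends to `0`
  have hratio : Tendsto (fun X : ℕ ↦ ((((heightFamilyBelow X).filter
      (fun AB ↦ (shortWeierstrass AB).toAffine.Point[(3 : ℤ)] ≠ ⊥)).card : ℕ) : ℝ) /
        (heightFamilyBelow X).card) atTop (𝓝 0) := by
    refine tendsto_of_tendsto_of_tendsto_of_le_of_le' tendsto_const_nhds tendsto_bound_div_lower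
      (Eventually.of_forall fun X ↦ by positivity) ?_
    filter_upwards [eventually_ge_atTop 29] with X hX
    have hX1 : 1 ≤ X := le_trans (by norm_num) hX
    have hXr : (29 : ℝ) ≤ X := by exact_mod_cast hX
    have hbad := card_filter_torsionBy_three_ne_bot_le X hX1
    have htot := card_heightFamilyBelow_ge X hX1
    have hN : ((X : ℝ) / 5) ^ ((3 : ℝ)⁻¹) - 1 ≤ ⌊((X : ℝ) / 5) ^ ((3 : ℝ)⁻¹)⌋₊ :=
      (Nat.sub_one_lt_floor _).le
    have hM : ((X : ℝ) / 28) ^ ((2 : ℝ)⁻¹) - 1 ≤ ⌊((X : ℝ) / 28) ^ ((2 : ℝ)⁻¹)⌋₊ :=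
      (Nat.sub_one_lt_floor _).le
    have hN0 : 0 < ((X : ℝ) / 5) ^ ((3 : ℝ)⁻¹) - 1 := by
      have : (1 : ℝ) < ((X : ℝ) / 5) ^ ((3 : ℝ)⁻¹) :=
        Real.one_lt_rpow (by rw [lt_div_iff₀ (by norm_num)]; linarith) (by norm_num)
      linarith
    have hM0 : 0 < ((X : ℝ) / 28) ^ ((2 : ℝ)⁻¹) - 1 := by
      have : (1 : ℝ) < ((X : ℝ) / 28) ^ ((2 : ℝ)⁻¹) :=
        Real.one_lt_rpow (by rw [lt_div_iff₀ (by norm_num)]; linarith) (by norm_num)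
      linarith
    have hg : (3 / 4 : ℝ) * (((X : ℝ) / 5) ^ ((3 : ℝ)⁻¹) - 1) * (((X : ℝ) / 28) ^ ((2 : ℝ)⁻¹) - 1) ≤
        (heightFamilyBelow X).card := by
      refine le_trans ?_ htot
      refine mul_le_mul (mul_le_mul_of_nonneg_left hN (by norm_num)) hM hM0.le (by positivity)
    have hgpos : 0 < (3 / 4 : ℝ) * (((X : ℝ) / 5) ^ ((3 : ℝ)⁻¹) - 1) *
        (((X : ℝ) / 28) ^ ((2 : ℝ)⁻¹) - 1) := by positivity
    exact div_le_div₀ (by positivity) hbad hgpos hg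
  -- the proportion is `1 - ratio` eventually
  have hlim : Tendsto (fun X : ℕ ↦ 1 - ((((heightFamilyBelow X).filter
      (fun AB ↦ (shortWeierstrass AB).toAffine.Point[(3 : ℤ)] ≠ ⊥)).card : ℕ) : ℝ) /
        (heightFamilyBelow X).card) atTop (𝓝 1) := by
    simpa using hratio.const_sub 1
  refine hlim.congr' ?_
  filter_upwards [eventually_ge_atTop 29] with X hX
  have hX1 : 1 ≤ X := le_trans (by norm_num) hX
  have hXr : (29 : ℝ) ≤ X := by exact_mod_cast hX
  -- the total count is positive
  have htot := card_heightFamilyBelow_ge X hX1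
  have hN1 : (1 : ℝ) ≤ ⌊((X : ℝ) / 5) ^ ((3 : ℝ)⁻¹)⌋₊ := by
    have : 1 ≤ ⌊((X : ℝ) / 5) ^ ((3 : ℝ)⁻¹)⌋₊ := Nat.le_floor (by
      rw [Nat.cast_one]
      exact Real.one_le_rpow (by rw [le_div_iff₀ (by norm_num)]; linarith) (by norm_num))
    exact_mod_cast this
  have hM1 : (1 : ℝ) ≤ ⌊((X : ℝ) / 28) ^ ((2 : ℝ)⁻¹)⌋₊ := by
    have : 1 ≤ ⌊((X : ℝ) / 28) ^ ((2 : ℝ)⁻¹)⌋₊ := Nat.le_floor (by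
      rw [Nat.cast_one]
      exact Real.one_le_rpow (by rw [le_div_iff₀ (by norm_num)]; linarith) (by norm_num))
    exact_mod_cast this
  have hpos : (0 : ℝ) < (heightFamilyBelow X).card := by
    refine lt_of_lt_of_le ?_ htot
    have : (3 / 4 : ℝ) * 1 * 1 ≤ (3 / 4 : ℝ) * ⌊((X : ℝ) / 5) ^ ((3 : ℝ)⁻¹)⌋₊ *
        ⌊((X : ℝ) / 28) ^ ((2 : ℝ)⁻¹)⌋₊ :=
      mul_le_mul (mul_le_mul_of_nonneg_left hN1 (by norm_num)) hM1 zero_le_one (by positivity)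
    linarith
  have hsplit := Finset.card_filter_add_card_filter_not (s := heightFamilyBelow X)
    (fun AB ↦ (shortWeierstrass AB).toAffine.Point[(3 : ℤ)] = ⊥)
  have hsplitR : ((((heightFamilyBelow X).filter
      (fun AB ↦ (shortWeierstrass AB).toAffine.Point[(3 : ℤ)] = ⊥)).card : ℕ) : ℝ) =
      (heightFamilyBelow X).card - ((((heightFamilyBelow X).filter
        (fun AB ↦ ¬ (shortWeierstrass AB).toAffine.Point[(3 : ℤ)] = ⊥)).card : ℕ) : ℝ) := by
    rw [eq_sub_iff_add_eq]; exact_mod_cast hsplit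
  rw [hprop X, hsplitR, sub_div, div_self hpos.ne']


end ThreeTorsion

/-! ### The deduction of Theorem 4 (source §4.1) -/

section Reduction

/-- Proportions in the height family are quotients of cardinalities:
`heightProportion P X = #{H < X, P} / #{H < X}` (unfolding `Literature.NumberTheory.EllipticCurves.heightProportion`,
`Literature.NumberTheory.EllipticCurves.heightAverage`; any decidability instance on `P`). [folklore] -/
theorem heightProportion_eq_card_div (P : ℤ × ℤ → Prop) [DecidablePred P] (X : ℕ) :
    heightProportion P X =
      (((heightFamilyBelow X).filter P).card : ℝ) / (heightFamilyBelow X).card := by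
  unfold heightProportion heightAverage
  rw [Finset.natCast_card_filter]
  congr 1
  exact Finset.sum_congr rfl fun x _ ↦ by beta_reduce; congr

/-- Averages over a finite **disjoint** union of subfamilies: if over each piece `S i` the average
of `f` is eventually `≤ C`, then eventually `∑_{U, H < X} f ≤ C · #{U, H < X}` for the union
`U = ⋃ S i` (add up the pieces; `U` is any predicate equivalent to `∃ i, S i`, e.g. `UnionMem F`).
Used to pass from Thm 27 for each sign piece of the source's family `F` to `F` itself. [folklore] -/
theorem eventually_sum_le_of_heightAverageOn_le {n : ℕ} (S : Fin n → ℤ × ℤ → Prop)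
    (hdisj : ∀ i j, i ≠ j → ∀ AB, S i AB → ¬ S j AB) (U : ℤ × ℤ → Prop)
    (hU : ∀ AB, U AB ↔ ∃ i, S i AB) (f : ℤ × ℤ → ℝ) {C : ℝ}
    (h : ∀ i, ∀ᶠ X : ℕ in atTop, heightAverageOn (S i) f X ≤ C) :
    ∀ᶠ X : ℕ in atTop, ∑ AB ∈ (heightFamilyBelow X).filter U, f AB ≤
      C * ((heightFamilyBelow X).filter U).card := by
  filter_upwards [Filter.eventually_all.mpr h] with X hX
  have hU' : (heightFamilyBelow X).filter U =
      (Finset.univ : Finset (Fin n)).biUnion fun i ↦ (heightFamilyBelow X).filter (S i) := by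
    ext AB
    simp only [Finset.mem_filter, Finset.mem_biUnion, Finset.mem_univ, true_and, hU AB,
      exists_and_left]
  have hpd : Set.PairwiseDisjoint (↑(Finset.univ : Finset (Fin n)))
      fun i ↦ (heightFamilyBelow X).filter (S i) := by
    intro i _ j _ hij
    rw [Function.onFun, Finset.disjoint_left]
    intro AB hi hj
    exact hdisj i j hij AB (Finset.mem_filter.mp hi).2 (Finset.mem_filter.mp hj).2
  rw [hU', Finset.sum_biUnion hpd, Finset.card_biUnion hpd, Nat.cast_sum, Finset.mul_sum]
  refine Finset.sum_le_sum fun i _ ↦ ?_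
  have hi := hX i
  unfold heightAverageOn at hi
  rcases Nat.eq_zero_or_pos ((heightFamilyBelow X).filter (S i)).card with h0 | hpos
  · rw [Finset.card_eq_zero.mp h0]
    simp
  · rwa [div_le_iff₀ (by exact_mod_cast hpos)] at hi

/-- The quadratic twist by `-1` on coefficients, `E_{A,B} ↦ E₋₁ = E_{A,-B}` (source §4.1: "the
twist `E₋₁` of `E` by `-1`"; `-y² = x³ + Ax + B` becomes `y² = x³ + Ax - B` under `x ↦ -x`).
[cite: BhargavaShankarTernary2015, §4.1 (arXiv v2)] -/
def negB (AB : ℤ × ℤ) : ℤ × ℤ := (AB.1, -AB.2)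

/-- `negB` is an involution. [folklore] -/
@[simp] theorem negB_negB (AB : ℤ × ℤ) : negB (negB AB) = AB := by
  simp [negB]

/-- `negB` is injective. [folklore] -/
theorem negB_injective : Function.Injective negB :=
  Function.LeftInverse.injective negB_negB

/-- `E_{A,-B}` is in the height family iff `E_{A,B}` is (`4A³ + 27B²` and `p⁶ ∣ B` are even in `B`).
[folklore] -/
theorem isInHeightFamily_negB (AB : ℤ × ℤ) : IsInHeightFamily (negB AB) ↔ IsInHeightFamily AB := by
  simp only [IsInHeightFamily, negB, even_two, Even.neg_pow, dvd_neg]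

/-- "The height of an elliptic curve also remains the same under twisting by `-1`" (source §4.1):
`H(E_{A,-B}) = H(E_{A,B})`. [cite: BhargavaShankarTernary2015, §4.1 (arXiv v2)] -/
theorem naiveHeight_negB (AB : ℤ × ℤ) : naiveHeight (negB AB) = naiveHeight AB := by
  simp only [naiveHeight, negB, even_two, Even.neg_pow]

/-- `negB` preserves the set of curves of naive height `< X`. [folklore] -/
theorem negB_mem_heightFamilyBelow (AB : ℤ × ℤ) (X : ℕ) :
    negB AB ∈ heightFamilyBelow X ↔ AB ∈ heightFamilyBelow X := by
  simp only [mem_heightFamilyBelow_iff, isInHeightFamily_negB, naiveHeight_negB]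

/-- **"Exactly `50%` of `F` has root number `+1`"** (source §4.1, last paragraph), at each finite
height: if `U` is stable under `E ↦ E₋₁` and `ω(E₋₁) = -ω(E)` on `U`, then among the members of `U`
of naive height `< X` as many have root number `+1` as not (`negB` is a height-preserving bijection
between the two sets; `ω ∈ {±1}` by `WeierstrassCurve.rootNumber_eq_one_or`).
[cite: BhargavaShankarTernary2015, §4.1 (arXiv v2)] -/
theorem card_filter_rootNumber_eq_one_eq (U : ℤ × ℤ → Prop) (hU : ∀ AB, U AB → U (negB AB))
    (hflip : ∀ AB, U AB →
      (shortWeierstrass (negB AB)).rootNumber = -(shortWeierstrass AB).rootNumber) (X : ℕ) :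
    (((heightFamilyBelow X).filter U).filter
        (fun AB ↦ (shortWeierstrass AB).rootNumber = 1)).card =
      (((heightFamilyBelow X).filter U).filter
        (fun AB ↦ ¬ (shortWeierstrass AB).rootNumber = 1)).card := by
  refine Finset.card_bij (fun AB _ ↦ negB AB) (fun AB hAB ↦ ?_) (fun a₁ _ a₂ _ h ↦ negB_injective h)
    (fun AB' hAB' ↦ ⟨negB AB', ?_, negB_negB AB'⟩)
  · simp only [Finset.mem_filter] at hAB ⊢
    refine ⟨⟨(negB_mem_heightFamilyBelow AB X).mpr hAB.1.1, hU AB hAB.1.2⟩, ?_⟩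
    rw [hflip AB hAB.1.2, hAB.2]
    norm_num
  · simp only [Finset.mem_filter] at hAB' ⊢
    refine ⟨⟨(negB_mem_heightFamilyBelow AB' X).mpr hAB'.1.1, hU AB' hAB'.1.2⟩, ?_⟩
    rw [hflip AB' hAB'.1.2]
    rcases (shortWeierstrass AB').rootNumber_eq_one_or with h | h
    · exact (hAB'.2 h).elim
    · rw [h]; norm_num

/-- **The counting in the proof of Thm 41 of the source, torsion-corrected, at a finite height `X`.**
Let `U` be stable under `E ↦ E₋₁` with `ω(E₋₁) = -ω(E)` on `U`, and suppose that at height `X`: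
the average of `#Sel^(3)` over `U` is `≤ 5` (h1; Thm 27 gives `≤ 4 + ε`), `U` has proportion `≥ c > 0`
among all curves (h2), and the curves with `E(ℚ)[3] = 0` have proportion `≥ 1 - c/18` (h4; Lemma 19).
Then the curves of rank `0` have proportion `≥ c/18`. Proof as printed: the `ω = -1` half of `U`
contributes `≥ 3` per curve (`three_le_natCard_selmerGroup_of_rootNumber_eq_neg_one`), the `ω = +1`
curves with `E(ℚ)[3] = 0` and `#Sel^(3) ≠ 1` contribute `≥ 9`
(`natCard_selmerGroup_eq_one_or_nine_le`), the curves with `E(ℚ)[3] ≠ 0` are at most `c/18` of all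
curves, and `#Sel^(3) = 1` gives rank `0`
(`mordellWeilRank_eq_zero_and_torsionBy_eq_bot_of_natCard_selmerGroup_eq_one`); the resulting linear
inequalities give `#{rank 0} ≥ (c/18) · #{all}` (the source's sharper bookkeeping yields `25%` of
`U`). [cite: BhargavaShankarTernary2015, proof of Thm 41 (arXiv v2 numbering)] -/
theorem markov_step (hDD : even_selmerRank_sub_torsionRank_iff) (U : ℤ × ℤ → Prop)
    (hU : ∀ AB, U AB → U (negB AB))
    (hflip : ∀ AB, U AB →
      (shortWeierstrass (negB AB)).rootNumber = -(shortWeierstrass AB).rootNumber)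
    {c : ℝ} (hc : 0 < c) (X : ℕ)
    (h1 : heightAverageOn U (fun AB ↦ (Nat.card ((shortWeierstrass AB).selmerGroup 3) : ℝ)) X ≤ 5)
    (h2 : c ≤ heightProportion U X)
    (h4 : 1 - c / 18 ≤
      heightProportion (fun AB ↦ (shortWeierstrass AB).toAffine.Point[(3 : ℤ)] = ⊥) X) :
    c / 18 ≤ heightProportion (fun AB ↦ (shortWeierstrass AB).mordellWeilRank = 0) X := by
  rw [heightProportion_eq_card_div] at h2 h4 ⊢
  unfold heightAverageOn at h1
  -- the total count is positive
  have hN : (0 : ℝ) < (heightFamilyBelow X).card := by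
    rcases (Nat.cast_nonneg (α := ℝ) (heightFamilyBelow X).card).lt_or_eq with h | h
    · exact h
    · rw [← h, div_zero] at h2; exact (not_lt.mpr h2 hc).elim
  have hNU : c * (heightFamilyBelow X).card ≤ ((heightFamilyBelow X).filter U).card :=
    (le_div_iff₀ hN).mp h2
  have hNU0 : (0 : ℝ) < ((heightFamilyBelow X).filter U).card :=
    lt_of_lt_of_le (mul_pos hc hN) hNU
  have hsum : ∑ AB ∈ (heightFamilyBelow X).filter U,
      (Nat.card ((shortWeierstrass AB).selmerGroup 3) : ℝ) ≤
        5 * ((heightFamilyBelow X).filter U).card := (div_le_iff₀ hNU0).mp h1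
  -- members of the height family are elliptic curves
  have hell : ∀ AB ∈ heightFamilyBelow X, (shortWeierstrass AB).IsElliptic :=
    fun AB hAB ↦ isElliptic_shortWeierstrass ((mem_heightFamilyBelow_iff AB X).mp hAB).1
  -- split according to the root number
  have hsplit := Finset.sum_filter_add_sum_filter_not ((heightFamilyBelow X).filter U)
    (fun AB ↦ (shortWeierstrass AB).rootNumber = 1)
    (fun AB ↦ (Nat.card ((shortWeierstrass AB).selmerGroup 3) : ℝ))
  have hcards := Finset.card_filter_add_card_filter_not (s := (heightFamilyBelow X).filter U)
    (fun AB ↦ (shortWeierstrass AB).rootNumber = 1)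
  have heq := card_filter_rootNumber_eq_one_eq U hU hflip X
  -- odd part: every term is `≥ 3`
  have hminus : (3 : ℝ) * (((heightFamilyBelow X).filter U).filter
      (fun AB ↦ ¬ (shortWeierstrass AB).rootNumber = 1)).card ≤
      ∑ AB ∈ ((heightFamilyBelow X).filter U).filter
        (fun AB ↦ ¬ (shortWeierstrass AB).rootNumber = 1),
        (Nat.card ((shortWeierstrass AB).selmerGroup 3) : ℝ) := by
    rw [mul_comm, ← nsmul_eq_mul]
    refine Finset.card_nsmul_le_sum _ _ _ fun AB hAB ↦ ?_
    simp only [Finset.mem_filter] at hAB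
    haveI := hell AB hAB.1.1
    have hw : (shortWeierstrass AB).rootNumber = -1 :=
      ((shortWeierstrass AB).rootNumber_eq_one_or).resolve_left hAB.2
    exact_mod_cast three_le_natCard_selmerGroup_of_rootNumber_eq_neg_one hDD _ hw
  -- even part, split further by `#Sel = 1` and by the triviality of `E(ℚ)[3]`
  have hP := Finset.card_filter_add_card_filter_not
    (s := ((heightFamilyBelow X).filter U).filter (fun AB ↦ (shortWeierstrass AB).rootNumber = 1))
    (fun AB ↦ Nat.card ((shortWeierstrass AB).selmerGroup 3) = 1)
  have hP' := Finset.card_filter_add_card_filter_not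
    (s := (((heightFamilyBelow X).filter U).filter
      (fun AB ↦ (shortWeierstrass AB).rootNumber = 1)).filter
      (fun AB ↦ ¬ Nat.card ((shortWeierstrass AB).selmerGroup 3) = 1))
    (fun AB ↦ (shortWeierstrass AB).toAffine.Point[(3 : ℤ)] = ⊥)
  -- the terms with `#Sel ≠ 1` and trivial `3`-torsion are `≥ 9`
  have hplus₂ : (9 : ℝ) * (((((heightFamilyBelow X).filter U).filter
      (fun AB ↦ (shortWeierstrass AB).rootNumber = 1)).filter
      (fun AB ↦ ¬ Nat.card ((shortWeierstrass AB).selmerGroup 3) = 1)).filter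
      (fun AB ↦ (shortWeierstrass AB).toAffine.Point[(3 : ℤ)] = ⊥)).card ≤
      ∑ AB ∈ ((((heightFamilyBelow X).filter U).filter
        (fun AB ↦ (shortWeierstrass AB).rootNumber = 1)).filter
        (fun AB ↦ ¬ Nat.card ((shortWeierstrass AB).selmerGroup 3) = 1)).filter
        (fun AB ↦ (shortWeierstrass AB).toAffine.Point[(3 : ℤ)] = ⊥),
        (Nat.card ((shortWeierstrass AB).selmerGroup 3) : ℝ) := by
    rw [mul_comm, ← nsmul_eq_mul]
    refine Finset.card_nsmul_le_sum _ _ _ fun AB hAB ↦ ?_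
    simp only [Finset.mem_filter] at hAB
    haveI := hell AB hAB.1.1.1.1
    have h9 :=
      (natCard_selmerGroup_eq_one_or_nine_le hDD _ hAB.1.1.2 hAB.2).resolve_left hAB.1.2
    exact_mod_cast h9
  have hplus_sub : ∑ AB ∈ ((((heightFamilyBelow X).filter U).filter
        (fun AB ↦ (shortWeierstrass AB).rootNumber = 1)).filter
        (fun AB ↦ ¬ Nat.card ((shortWeierstrass AB).selmerGroup 3) = 1)).filter
        (fun AB ↦ (shortWeierstrass AB).toAffine.Point[(3 : ℤ)] = ⊥),
        (Nat.card ((shortWeierstrass AB).selmerGroup 3) : ℝ) ≤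
      ∑ AB ∈ ((heightFamilyBelow X).filter U).filter
        (fun AB ↦ (shortWeierstrass AB).rootNumber = 1),
        (Nat.card ((shortWeierstrass AB).selmerGroup 3) : ℝ) :=
    Finset.sum_le_sum_of_subset_of_nonneg
      ((Finset.filter_subset _ _).trans (Finset.filter_subset _ _))
      fun _ _ _ ↦ Nat.cast_nonneg _
  -- the `#Sel = 1` part consists of rank-`0` curves
  have ha : ((((heightFamilyBelow X).filter U).filter
      (fun AB ↦ (shortWeierstrass AB).rootNumber = 1)).filter
      (fun AB ↦ Nat.card ((shortWeierstrass AB).selmerGroup 3) = 1)).card ≤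
      ((heightFamilyBelow X).filter (fun AB ↦ (shortWeierstrass AB).mordellWeilRank = 0)).card := by
    refine Finset.card_le_card fun AB hAB ↦ ?_
    simp only [Finset.mem_filter] at hAB ⊢
    haveI := hell AB hAB.1.1.1
    exact ⟨hAB.1.1.1,
      (mordellWeilRank_eq_zero_and_torsionBy_eq_bot_of_natCard_selmerGroup_eq_one _ hAB.2).1⟩
  -- the part with non-trivial `3`-torsion lies in the exceptional set
  have hb : (((((heightFamilyBelow X).filter U).filter
      (fun AB ↦ (shortWeierstrass AB).rootNumber = 1)).filter
      (fun AB ↦ ¬ Nat.card ((shortWeierstrass AB).selmerGroup 3) = 1)).filter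
      (fun AB ↦ ¬ (shortWeierstrass AB).toAffine.Point[(3 : ℤ)] = ⊥)).card ≤
      ((heightFamilyBelow X).filter
        (fun AB ↦ ¬ (shortWeierstrass AB).toAffine.Point[(3 : ℤ)] = ⊥)).card :=
    Finset.card_le_card (Finset.filter_subset_filter _
      ((Finset.filter_subset _ _).trans ((Finset.filter_subset _ _).trans
        (Finset.filter_subset _ _))))
  -- the exceptional (torsion) set is small
  have hTcards := Finset.card_filter_add_card_filter_not (s := heightFamilyBelow X)
    (fun AB ↦ (shortWeierstrass AB).toAffine.Point[(3 : ℤ)] = ⊥)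
  have hT : (1 - c / 18) * (heightFamilyBelow X).card ≤ ((heightFamilyBelow X).filter
      (fun AB ↦ (shortWeierstrass AB).toAffine.Point[(3 : ℤ)] = ⊥)).card :=
    (le_div_iff₀ hN).mp h4
  rw [sub_mul, one_mul, div_mul_eq_mul_div] at hT
  -- arithmetic
  rw [le_div_iff₀ hN, div_mul_eq_mul_div]
  have hcards' := congrArg (Nat.cast (R := ℝ)) hcards
  have heq' := congrArg (Nat.cast (R := ℝ)) heq
  have hP₁ := congrArg (Nat.cast (R := ℝ)) hP
  have hP₂ := congrArg (Nat.cast (R := ℝ)) hP'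
  have hTcards' := congrArg (Nat.cast (R := ℝ)) hTcards
  have ha' := Nat.cast_le (α := ℝ).mpr ha
  have hb' := Nat.cast_le (α := ℝ).mpr hb
  push_cast at hcards' heq' hP₁ hP₂ hTcards' ha' hb'
  linarith [hsum, hsplit, hminus, hplus₂, hplus_sub, hNU, hT, hcards', heq', hP₁, hP₂, hTcards',
    ha', hb']

/-- **Theorem 4 of the source from its four inputs.** If (h₁) the average of `#Sel^(3)` over every
large congruence family is eventually `≤ 4 + ε` (Thm 27), (h₂) there is a finite disjoint union `U` of
large congruence families of positive proportion, stable under `E ↦ E₋₁` with `ω(E₋₁) = -ω(E)`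
(§4.1), and (h₃) the parity theorem of Dokchitser–Dokchitser holds in the form of Thm 42, then a
positive proportion of elliptic curves over `ℚ`, ordered by naive height, have Mordell–Weil rank
`0`: the named fact `Literature.NumberTheory.EllipticCurves.pos_proportion_rank_zero`, with `δ = c/18` for the proportion `c` of
`U`. The fourth input of the printed proof, `100%` of curves have no rational `3`-torsion (Lemma
19), is the theorem `hasHeightDensity_torsionBy_three_eq_bot`; the Mordell–Weil theorem (the tree's
`module_finite_point_holds`) and the Kummer sequence (`exists_kummerMap_holds`) enter through the
lemmas above; everything else is the printed counting (`markov_step`,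
`eventually_sum_le_of_heightAverageOn_le` for the two sign pieces of `F`).
[cite: BhargavaShankarTernary2015, Thm 4 and §4.1 (arXiv v2 numbering)] -/
theorem pos_proportion_rank_zero_of_facts (h₁ : heightAverageOn_card_selmerThree_le_four)
    (h₂ : exists_isLarge_rootNumber_twist_family) (h₃ : even_selmerRank_sub_torsionRank_iff) :
    pos_proportion_rank_zero := by
  obtain ⟨n, F, hlarge, hdisj, htwist, hflip, c, hc, hdens⟩ := h₂
  refine ⟨c / 18, by positivity, fun ε hε ↦ ?_⟩
  -- Thm 27 on each (disjoint) piece, summed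
  have e1 := eventually_sum_le_of_heightAverageOn_le (fun i ↦ (F i).Mem) hdisj (UnionMem F)
    (fun _ ↦ Iff.rfl) (fun AB ↦ (Nat.card ((shortWeierstrass AB).selmerGroup 3) : ℝ))
    (fun i ↦ h₁ (F i) (hlarge i) 1 one_pos)
  have e4 := Filter.Tendsto.eventually_const_le (show (1 : ℝ) - c / 18 < 1 by linarith)
    hasHeightDensity_torsionBy_three_eq_bot
  filter_upwards [e1, hdens, e4] with X hX1 hX2 hX4
  have hX1' : heightAverageOn (UnionMem F)
      (fun AB ↦ (Nat.card ((shortWeierstrass AB).selmerGroup 3) : ℝ)) X ≤ 5 := by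
    unfold heightAverageOn
    rcases Nat.eq_zero_or_pos ((heightFamilyBelow X).filter (UnionMem F)).card with h0 | hpos
    · rw [h0, Nat.cast_zero, div_zero]; norm_num
    · rw [div_le_iff₀ (by exact_mod_cast hpos)]
      have : (4 : ℝ) + 1 = 5 := by norm_num
      rw [this] at hX1
      exact hX1
  have h := markov_step h₃ (UnionMem F) htwist hflip hc X hX1' hX2 hX4
  linarith

end Reduction

end Literature.NumberTheory.EllipticCurves

end
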